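import Literature.NumberTheory.Automorphic.ArchHeckeTestVectorConstructionGL2
import Literature.NumberTheory.Automorphic.ArchUnitarityBoundsGL2Real
import HarnessLib

/-!
# Unitarity bounds on the complex-place parameters of `GL₂(K_∞)`: `|im ν| < m/2 + 1`
# (Knapp (1986), Ch. XVI §1, Thm. 16.2 for `SL(2, ℂ)`; Jacquet–Langlands (1970), §6 Thm. 6.2)

Topic `NumberTheory/Automorphic`; namespace `Literature.NumberTheory.Automorphic`. Theorems only (no
definition, no named fact, no instance). Companion of `ArchUnitarityBoundsGL2Real` at the COMPLEX places.
In the tree's classification-free Kirillov theory of `GL₂(K_∞)` (`ArchKirillovShapeTypesGL2`,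
`ArchHeckeTestVectorConstructionGL2`) a complex place `w` of an irreducible unitary `τ` carries the central
scalars `μ₁ = τ(1 ⊗ c_w)`, `μ₂ = τ(1 ⊗ i c_w)`, the antiholomorphic and holomorphic Casimir scalars
`λ^a = (μ₁+iμ₂)²/2 - 2ν² - 2`, `λ^h = (μ₁-iμ₂)²/2 - 2ν'² - 2`, and the minimal `SU(2)_w`-type `m` of a
highest-weight vector `y` (`E y = 0`, `τ(T) y = im y`, `ComplexInner`); the Kirillov functions of the tagged
vectors are `|z|^β k_ν(|z|)`, `|z|^β k_{ν'}(|z|)`, `|z|^β k_{ν-ij}(|z|)` (`k = besselMode 4π`). The Hecke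
theory needed only SOME half-plane of convergence, so `ν, ν'` were arbitrary; the Rankin–Selberg theory
(`HumphriesJo2024_archRankinSelberg_testVector`: identities on ALL of `re s > 1`, Gamma shifts of real
part `> -1`) needs the UNITARITY BOUNDS proved here, from the skew-symmetry of `τ(X)` (`X` real) on the
Gårding space (`inner_gardingEnd_eq_neg`) alone:

* §1 `inner_gardingEndHol_left` & co. — `τ^h(E_{ij})* = -τ^a(E_{ij})` (`conj i = -i`);
* §2 `re_complexCentral_eq_zero` — `re μ₁ = re μ₂ = 0`; `conj_placeCasimirAnti_eq` — **`conj λ^a = λ^h`**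
  (`(τ^a(E_{ij})τ^a(E_{ji}))* = τ^h(E_{ij})τ^h(E_{ji})`); hence `besselParamC_sq_eq_conj_sq` — `ν'² = (conj ν)²`,
  `|im ν'| = |im ν|`; and with the minimal-type relation of a string (`exists_string_relation`,
  `λ^h = (μ₁-iμ₂)²/2 - 2(ν - im)² - 2`, `m ≠ 0`) `im_besselParamC_eq_half_of_string` — **`im ν = m/2`**
  (tempered), so the string indices `ν - ij` have `|im| ≤ m/2` (`abs_im_besselParamC_string_le`);
* §3 the `𝔨/𝔭` decomposition `K_{ij} = τ^h(E_{ij}) - τ^a(E_{ji})` (`K₀₁ = E`, `K₁₀ = F`, spanning `𝔲(2)_ℂ`),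
  `P_{ij} = τ^h(E_{ij}) + τ^a(E_{ji})` (`𝔭_ℂ`): adjoints `K_{ij}* = K_{ji}`, `P_{ij}* = -P_{ji}`, and the
  identities `K_{ij}K_{ji} + P_{ij}P_{ji} = 2τ^h(E_{ij})τ^h(E_{ji}) + 2τ^a(E_{ji})τ^a(E_{ij})`
  (`Ω_𝔨 + Ω_𝔭 = 2C^h + 2C^a`), `C^h - C^a = Σ P_{ij}K_{ji}`, `[K₀₁, P₁₀] = 2(P₀₀ - P₁₁)`;
* §4 `sq_im_besselParamC_le` (**main**) — for a non-zero highest-weight `y` of torus weight `m` of a unitary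
  `τ`: `(im ν)² ≤ ((m+2)/2)²`, with equality only if `P₀₁ y = 0`. Evaluating §3 on `y` against `y`:
  `Σ‖P_{ij}y‖² = (2m² + 4m + 2|μ₁|² + 8 re ν² + 8)‖y‖²`, `(m+2)⟪y,(P₀₀-P₁₁)y⟫ = 8i re ν im ν ‖y‖²`,
  `⟪y,(P₀₀+P₁₁)y⟫ = 2μ₁‖y‖²`, and Cauchy–Schwarz give
  `4‖y‖⁴((m+2)² + 4(re ν)²)((m+2)² - 4(im ν)²) ≥ 2(m+2)²‖y‖²(‖P₀₁y‖² + ‖P₁₀y‖²) + 8m(m+2)²‖y‖⁴ ≥ 0`.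
  Corollaries `abs_im_besselParamC_le/lt_of_ne`, and for `τ` irreducible with a non-zero continuous
  Whittaker functional and `y` `K_∞`-finite (`τ^h(E₀₁) y = 0` would put `y` in the Kirillov null space)
  `complexPlace_unitarityBounds`, `ComplexInner.unitarityBounds`: **`|im ν|, |im ν'| < m/2 + 1`** — the
  classification-free form of "unitary principal series, or complementary series of parameter `< 1`"
  for `GL₂(ℂ)` (Knapp, Thm. 16.2), which is what the Rankin–Selberg Gamma bookkeeping needs
  (`re` of the shifts `((n+n')/2 ± iν ± iν̄')/2 > -1`, `n ≥ m` the `SU(2)`-type of the test vector).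

## References

* A. W. Knapp, *Representation Theory of Semisimple Groups* (1986), Ch. II §4, Ch. III §3, Ch. XVI §1
  Thm. 16.2 [Knapp1986].
* H. Jacquet, R. P. Langlands, *Automorphic Forms on GL(2)*, LNM 114 (1970), §6 (Thm. 6.2, Lemma 6.1)
  [JacquetLanglands1970].
* P. Humphries, Y. Jo, *Test vectors for archimedean period integrals*, Publ. Mat. 68 (2024), §2
  [HumphriesJo2024].
-/

noncomputable section

open MeasureTheory Measure NumberField NumberField.InfinitePlace NumberField.mixedEmbedding IsDedekindDomain Set Filter
open scoped MatrixGroups Topology Classical InnerProductSpace ComplexConjugate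

namespace Literature.NumberTheory.Automorphic

variable {K : Type} [Field K] [NumberField K]

-- as in `ArchGardingWhittaker`
set_option backward.isDefEq.respectTransparency false

section ComplexPlace

variable {hcpt : isCompact_glFiniteIntegralLevel 2 K}
  {E : Type*} [NormedAddCommGroup E] [InnerProductSpace ℂ E] [CompleteSpace E]
  {τ : ContRepresentation ℂ (AutomorphyDatum.gl 2 K hcpt).arch.carrier E}
  (hτ : τ.IsStronglyContinuous) (w : {w : InfinitePlace K // IsComplex w})

/-! ### 1. Adjoints: `τ^h(E_{ij})* = -τ^a(E_{ij})` on the Gårding space of a unitary representation -/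

/-- **`⟪τ^h(E_{ij}) u, v⟫ = -⟪u, τ^a(E_{ij}) v⟫`** (`τ(X)` is skew-symmetric for real `X`, and `conj i = -i`).
[cite: Knapp1986, Ch. III §3] -/
theorem inner_gardingEndHol_left (hτu : τ.IsUnitary) (i j : Fin 2) (u v : archGardingSpace hcpt τ) :
    ⟪(((gardingEnd (hcpt := hcpt) (τ := τ) hτ (Matrix.single (i : Fin 2) (j : Fin 2) ((0, Pi.single w 1) : mixedSpace K)) - Complex.I • gardingEnd (hcpt := hcpt) (τ := τ) hτ (Matrix.single (i : Fin 2) (j : Fin 2) ((0, Pi.single w Complex.I) : mixedSpace K))) u : archGardingSpace hcpt τ) : E), (v : E)⟫_ℂ = -⟪(u : E), (((gardingEnd (hcpt := hcpt) (τ := τ) hτ (Matrix.single (i : Fin 2) (j : Fin 2) ((0, Pi.single w 1) : mixedSpace K)) + Complex.I • gardingEnd (hcpt := hcpt) (τ := τ) hτ (Matrix.single (i : Fin 2) (j : Fin 2) ((0, Pi.single w Complex.I) : mixedSpace K))) v : archGardingSpace hcpt τ) : E)⟫_ℂ := by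
  rw [LinearMap.sub_apply, LinearMap.smul_apply, Submodule.coe_sub, Submodule.coe_smul, inner_sub_left, inner_smul_left,
    LinearMap.add_apply, LinearMap.smul_apply, Submodule.coe_add, Submodule.coe_smul, inner_add_right, inner_smul_right,
    inner_gardingEnd_eq_neg hτ hτu, inner_gardingEnd_eq_neg hτ hτu, Complex.conj_I]
  ring

/-- **`⟪τ^a(E_{ij}) u, v⟫ = -⟪u, τ^h(E_{ij}) v⟫.** [cite: Knapp1986, Ch. III §3] -/
theorem inner_gardingEndAnti_left (hτu : τ.IsUnitary) (i j : Fin 2) (u v : archGardingSpace hcpt τ) :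
    ⟪(((gardingEnd (hcpt := hcpt) (τ := τ) hτ (Matrix.single (i : Fin 2) (j : Fin 2) ((0, Pi.single w 1) : mixedSpace K)) + Complex.I • gardingEnd (hcpt := hcpt) (τ := τ) hτ (Matrix.single (i : Fin 2) (j : Fin 2) ((0, Pi.single w Complex.I) : mixedSpace K))) u : archGardingSpace hcpt τ) : E), (v : E)⟫_ℂ = -⟪(u : E), (((gardingEnd (hcpt := hcpt) (τ := τ) hτ (Matrix.single (i : Fin 2) (j : Fin 2) ((0, Pi.single w 1) : mixedSpace K)) - Complex.I • gardingEnd (hcpt := hcpt) (τ := τ) hτ (Matrix.single (i : Fin 2) (j : Fin 2) ((0, Pi.single w Complex.I) : mixedSpace K))) v : archGardingSpace hcpt τ) : E)⟫_ℂ := by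
  rw [LinearMap.add_apply, LinearMap.smul_apply, Submodule.coe_add, Submodule.coe_smul, inner_add_left, inner_smul_left,
    LinearMap.sub_apply, LinearMap.smul_apply, Submodule.coe_sub, Submodule.coe_smul, inner_sub_right, inner_smul_right,
    inner_gardingEnd_eq_neg hτ hτu, inner_gardingEnd_eq_neg hτ hτu, Complex.conj_I]
  ring

/-- `⟪u, τ^h(E_{ij}) v⟫ = -⟪τ^a(E_{ij}) u, v⟫`. [cite: Knapp1986, Ch. III §3] -/
theorem inner_gardingEndHol_right (hτu : τ.IsUnitary) (i j : Fin 2) (u v : archGardingSpace hcpt τ) :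
    ⟪(u : E), (((gardingEnd (hcpt := hcpt) (τ := τ) hτ (Matrix.single (i : Fin 2) (j : Fin 2) ((0, Pi.single w 1) : mixedSpace K)) - Complex.I • gardingEnd (hcpt := hcpt) (τ := τ) hτ (Matrix.single (i : Fin 2) (j : Fin 2) ((0, Pi.single w Complex.I) : mixedSpace K))) v : archGardingSpace hcpt τ) : E)⟫_ℂ = -⟪(((gardingEnd (hcpt := hcpt) (τ := τ) hτ (Matrix.single (i : Fin 2) (j : Fin 2) ((0, Pi.single w 1) : mixedSpace K)) + Complex.I • gardingEnd (hcpt := hcpt) (τ := τ) hτ (Matrix.single (i : Fin 2) (j : Fin 2) ((0, Pi.single w Complex.I) : mixedSpace K))) u : archGardingSpace hcpt τ) : E), (v : E)⟫_ℂ := by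
  rw [inner_gardingEndAnti_left hτ w hτu, neg_neg]

/-- `⟪u, τ^a(E_{ij}) v⟫ = -⟪τ^h(E_{ij}) u, v⟫`. [cite: Knapp1986, Ch. III §3] -/
theorem inner_gardingEndAnti_right (hτu : τ.IsUnitary) (i j : Fin 2) (u v : archGardingSpace hcpt τ) :
    ⟪(u : E), (((gardingEnd (hcpt := hcpt) (τ := τ) hτ (Matrix.single (i : Fin 2) (j : Fin 2) ((0, Pi.single w 1) : mixedSpace K)) + Complex.I • gardingEnd (hcpt := hcpt) (τ := τ) hτ (Matrix.single (i : Fin 2) (j : Fin 2) ((0, Pi.single w Complex.I) : mixedSpace K))) v : archGardingSpace hcpt τ) : E)⟫_ℂ = -⟪(((gardingEnd (hcpt := hcpt) (τ := τ) hτ (Matrix.single (i : Fin 2) (j : Fin 2) ((0, Pi.single w 1) : mixedSpace K)) - Complex.I • gardingEnd (hcpt := hcpt) (τ := τ) hτ (Matrix.single (i : Fin 2) (j : Fin 2) ((0, Pi.single w Complex.I) : mixedSpace K))) u : archGardingSpace hcpt τ) : E), (v : E)⟫_ℂ := by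
  rw [inner_gardingEndHol_left hτ w hτu, neg_neg]

/-! ### 2. The scalars of the place: central scalars purely imaginary, the two Casimir scalars conjugate -/

/-- **The central scalars `μ₁ = τ(1 ⊗ c_w)`, `μ₂ = τ(1 ⊗ i c_w)` of a unitary representation are purely
imaginary.** [cite: Knapp1986, Ch. III §3] -/
theorem re_complexCentral_eq_zero (hτu : τ.IsUnitary) {μ₁ μ₂ : ℂ}
    (hZ1 : ∀ v : archGardingSpace hcpt τ, gardingEnd (hcpt := hcpt) (τ := τ) hτ (Matrix.single 0 0 ((0, Pi.single w 1) : mixedSpace K) + Matrix.single 1 1 ((0, Pi.single w 1) : mixedSpace K)) v = μ₁ • v)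
    (hZ2 : ∀ v : archGardingSpace hcpt τ, gardingEnd (hcpt := hcpt) (τ := τ) hτ (Matrix.single (0 : Fin 2) (0 : Fin 2) ((0, Pi.single w Complex.I) : mixedSpace K) + Matrix.single (1 : Fin 2) (1 : Fin 2) ((0, Pi.single w Complex.I) : mixedSpace K)) v = μ₂ • v)
    {v : archGardingSpace hcpt τ} (hv0 : v ≠ 0) : μ₁.re = 0 ∧ μ₂.re = 0 :=
  ⟨re_eq_zero_of_gardingEnd_eq_smul hτ hτu _ hv0 (hZ1 v), re_eq_zero_of_gardingEnd_eq_smul hτ hτu _ hv0 (hZ2 v)⟩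

/-- **The antiholomorphic and holomorphic Casimir scalars of a unitary representation are complex conjugate**:
`conj λ^a = λ^h` (`(τ^a(E_{ij}) τ^a(E_{ji}))* = τ^h(E_{ij}) τ^h(E_{ji})`). [cite: Knapp1986, Ch. VIII §3] -/
theorem conj_placeCasimirAnti_eq (hτu : τ.IsUnitary) {lama lamh : ℂ} {v : archGardingSpace hcpt τ} (hv0 : v ≠ 0)
    (hCa : ∑ i : Fin 2, ∑ j : Fin 2, (gardingEnd (hcpt := hcpt) (τ := τ) hτ (Matrix.single (i : Fin 2) (j : Fin 2) ((0, Pi.single w 1) : mixedSpace K)) + Complex.I • gardingEnd (hcpt := hcpt) (τ := τ) hτ (Matrix.single (i : Fin 2) (j : Fin 2) ((0, Pi.single w Complex.I) : mixedSpace K))) ((gardingEnd (hcpt := hcpt) (τ := τ) hτ (Matrix.single (j : Fin 2) (i : Fin 2) ((0, Pi.single w 1) : mixedSpace K)) + Complex.I • gardingEnd (hcpt := hcpt) (τ := τ) hτ (Matrix.single (j : Fin 2) (i : Fin 2) ((0, Pi.single w Complex.I) : mixedSpace K))) v) = lama • v)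
    (hCh : ∑ i : Fin 2, ∑ j : Fin 2, (gardingEnd (hcpt := hcpt) (τ := τ) hτ (Matrix.single (i : Fin 2) (j : Fin 2) ((0, Pi.single w 1) : mixedSpace K)) - Complex.I • gardingEnd (hcpt := hcpt) (τ := τ) hτ (Matrix.single (i : Fin 2) (j : Fin 2) ((0, Pi.single w Complex.I) : mixedSpace K))) ((gardingEnd (hcpt := hcpt) (τ := τ) hτ (Matrix.single (j : Fin 2) (i : Fin 2) ((0, Pi.single w 1) : mixedSpace K)) - Complex.I • gardingEnd (hcpt := hcpt) (τ := τ) hτ (Matrix.single (j : Fin 2) (i : Fin 2) ((0, Pi.single w Complex.I) : mixedSpace K))) v) = lamh • v) : conj lama = lamh := by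
  have hvv : ⟪(v : E), (v : E)⟫_ℂ ≠ 0 := by
    rw [inner_self_ne_zero]
    exact fun h0 => hv0 (Subtype.ext h0)
  have h1 : ⟪((∑ i : Fin 2, ∑ j : Fin 2, (gardingEnd (hcpt := hcpt) (τ := τ) hτ (Matrix.single (i : Fin 2) (j : Fin 2) ((0, Pi.single w 1) : mixedSpace K)) + Complex.I • gardingEnd (hcpt := hcpt) (τ := τ) hτ (Matrix.single (i : Fin 2) (j : Fin 2) ((0, Pi.single w Complex.I) : mixedSpace K))) ((gardingEnd (hcpt := hcpt) (τ := τ) hτ (Matrix.single (j : Fin 2) (i : Fin 2) ((0, Pi.single w 1) : mixedSpace K)) + Complex.I • gardingEnd (hcpt := hcpt) (τ := τ) hτ (Matrix.single (j : Fin 2) (i : Fin 2) ((0, Pi.single w Complex.I) : mixedSpace K))) v) : archGardingSpace hcpt τ) : E), (v : E)⟫_ℂ =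
      ⟪(v : E), ((∑ i : Fin 2, ∑ j : Fin 2, (gardingEnd (hcpt := hcpt) (τ := τ) hτ (Matrix.single (i : Fin 2) (j : Fin 2) ((0, Pi.single w 1) : mixedSpace K)) - Complex.I • gardingEnd (hcpt := hcpt) (τ := τ) hτ (Matrix.single (i : Fin 2) (j : Fin 2) ((0, Pi.single w Complex.I) : mixedSpace K))) ((gardingEnd (hcpt := hcpt) (τ := τ) hτ (Matrix.single (j : Fin 2) (i : Fin 2) ((0, Pi.single w 1) : mixedSpace K)) - Complex.I • gardingEnd (hcpt := hcpt) (τ := τ) hτ (Matrix.single (j : Fin 2) (i : Fin 2) ((0, Pi.single w Complex.I) : mixedSpace K))) v) : archGardingSpace hcpt τ) : E)⟫_ℂ := by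
    simp only [AddSubmonoidClass.coe_finsetSum, sum_inner, inner_sum]
    rw [Finset.sum_comm]
    refine Finset.sum_congr rfl fun i _ => Finset.sum_congr rfl fun j _ => ?_
    rw [inner_gardingEndAnti_left hτ w hτu, inner_gardingEndAnti_left hτ w hτu, neg_neg]
  rw [hCa, hCh, Submodule.coe_smul, Submodule.coe_smul, inner_smul_left, inner_smul_right] at h1
  exact mul_right_cancel₀ hvv h1

/-- **The two Bessel parameters of a complex place have conjugate squares**: if `λ^a = (μ₁+iμ₂)²/2 - 2ν² - 2`,
`λ^h = (μ₁-iμ₂)²/2 - 2ν'² - 2` with `μ₁, μ₂` purely imaginary and `conj λ^a = λ^h`, then `ν'² = (conj ν)²`; hence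
`|im ν'| = |im ν|` and `|re ν'| = |re ν|`. [cite: JacquetLanglands1970, §6 Thm. 6.2] -/
theorem besselParamC_sq_eq_conj_sq {μ₁ μ₂ lama lamh ν ν' : ℂ} (hμ₁ : μ₁.re = 0) (hμ₂ : μ₂.re = 0)
    (hconj : conj lama = lamh)
    (hlama : lama = (μ₁ + Complex.I * μ₂) ^ 2 / 2 - 2 * ν ^ 2 - 2)
    (hlamh : lamh = (μ₁ - Complex.I * μ₂) ^ 2 / 2 - 2 * ν' ^ 2 - 2) :
    ν' ^ 2 = (conj ν) ^ 2 ∧ |ν'.im| = |ν.im| ∧ |ν'.re| = |ν.re| := by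
  have hμ₁' : conj μ₁ = -μ₁ := by
    apply Complex.ext <;> simp [hμ₁]
  have hμ₂' : conj μ₂ = -μ₂ := by
    apply Complex.ext <;> simp [hμ₂]
  have hsq : ν' ^ 2 = (conj ν) ^ 2 := by
    have h := hconj
    rw [hlama, hlamh] at h
    simp only [map_sub, map_div₀, map_pow, map_add, map_mul, Complex.conj_I, hμ₁', hμ₂', Complex.conj_ofNat] at h
    have h2 : (conj (2 : ℂ)) = 2 := Complex.conj_ofNat 2
    have e : (-μ₁ + -Complex.I * -μ₂) ^ 2 = (μ₁ - Complex.I * μ₂) ^ 2 := by ring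
    rw [e] at h
    linear_combination (1 / 2 : ℂ) * h
  refine ⟨hsq, ?_, ?_⟩
  · rcases sq_eq_sq_iff_eq_or_eq_neg.mp hsq with h | h
    · rw [h, Complex.conj_im, abs_neg]
    · rw [h, Complex.neg_im, Complex.conj_im, neg_neg]
  · rcases sq_eq_sq_iff_eq_or_eq_neg.mp hsq with h | h
    · rw [h, Complex.conj_re]
    · rw [h, Complex.neg_re, Complex.conj_re, abs_neg]

/-- **On a string (`m ≠ 0`) the Bessel parameter has imaginary part exactly `m/2`** (tempered): if moreover the
minimal-type relation `λ^h = (μ₁-iμ₂)²/2 - 2(ν - im)² - 2` holds (`exists_string_relation`), then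
`(ν - im)² = (conj ν)²`, and `ν + conj ν = im` being impossible for `m ≠ 0`, `ν - conj ν = im`.
[cite: JacquetLanglands1970, §6 Thm. 6.2] [cite: Knapp1986, Ch. XVI §1] -/
theorem im_besselParamC_eq_half_of_string {μ₁ μ₂ lama lamh ν : ℂ} {m : ℕ} (hm : m ≠ 0) (hμ₁ : μ₁.re = 0) (hμ₂ : μ₂.re = 0)
    (hconj : conj lama = lamh)
    (hlama : lama = (μ₁ + Complex.I * μ₂) ^ 2 / 2 - 2 * ν ^ 2 - 2)
    (hlamh : lamh = (μ₁ - Complex.I * μ₂) ^ 2 / 2 - 2 * (ν - Complex.I * m) ^ 2 - 2) :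
    ν.im = (m : ℝ) / 2 := by
  obtain ⟨hsq, -, -⟩ := besselParamC_sq_eq_conj_sq hμ₁ hμ₂ hconj hlama hlamh
  rcases sq_eq_sq_iff_eq_or_eq_neg.mp hsq with h | h
  · have him := congrArg Complex.im h
    simp only [Complex.sub_im, Complex.mul_im, Complex.I_re, Complex.I_im, Complex.natCast_re, Complex.natCast_im,
      Complex.conj_im, zero_mul, one_mul] at him
    linarith
  · exfalso
    have hre := congrArg Complex.re h
    have him := congrArg Complex.im h
    simp only [Complex.sub_re, Complex.mul_re, Complex.I_re, Complex.I_im, Complex.natCast_re, Complex.natCast_im,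
      Complex.neg_re, Complex.conj_re, zero_mul, sub_zero, mul_zero] at hre
    simp only [Complex.sub_im, Complex.mul_im, Complex.I_re, Complex.I_im, Complex.natCast_re, Complex.natCast_im,
      Complex.neg_im, Complex.conj_im, zero_mul, one_mul, neg_neg] at him
    have hm' : (m : ℝ) ≠ 0 := by exact_mod_cast hm
    apply hm'
    linarith

/-- **The string indices `ν - ij`, `0 ≤ j ≤ m`, have `|im (ν - ij)| ≤ m/2`** on a string (`im ν = m/2`).
[cite: JacquetLanglands1970, §6 Thm. 6.2] -/
theorem abs_im_besselParamC_string_le {μ₁ μ₂ lama lamh ν : ℂ} {m : ℕ} (hm : m ≠ 0) (hμ₁ : μ₁.re = 0) (hμ₂ : μ₂.re = 0)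
    (hconj : conj lama = lamh)
    (hlama : lama = (μ₁ + Complex.I * μ₂) ^ 2 / 2 - 2 * ν ^ 2 - 2)
    (hlamh : lamh = (μ₁ - Complex.I * μ₂) ^ 2 / 2 - 2 * (ν - Complex.I * m) ^ 2 - 2) {j : ℕ} (hj : j ≤ m) :
    |(ν - Complex.I * j).im| ≤ (m : ℝ) / 2 := by
  have h := im_besselParamC_eq_half_of_string hm hμ₁ hμ₂ hconj hlama hlamh
  have hj' : (j : ℝ) ≤ m := by exact_mod_cast hj
  have hj0 : (0 : ℝ) ≤ j := Nat.cast_nonneg j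
  simp only [Complex.sub_im, Complex.mul_im, Complex.I_re, Complex.I_im, Complex.natCast_re, Complex.natCast_im,
    zero_mul, one_mul, h]
  rw [abs_le]
  constructor <;> linarith

/-! ### 3. The `𝔨/𝔭`-decomposition at a complex place: `K_{ij} = τ^h(E_{ij}) - τ^a(E_{ji})` (spanning `𝔲(2)_ℂ`),
`P_{ij} = τ^h(E_{ij}) + τ^a(E_{ji})` (spanning `𝔭_ℂ`); adjoints `K_{ij}* = K_{ji}`, `P_{ij}* = -P_{ji}` -/

/-- `⟪u, K_{ij} v⟫ = ⟪K_{ji} u, v⟫` (inner products of the Gårding space). [cite: Knapp1986, Ch. III §3] -/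
theorem inner_kPart_right (hτu : τ.IsUnitary) (i j : Fin 2) (u v : archGardingSpace hcpt τ) :
    ⟪u, ((gardingEnd (hcpt := hcpt) (τ := τ) hτ (Matrix.single (i : Fin 2) (j : Fin 2) ((0, Pi.single w 1) : mixedSpace K)) - Complex.I • gardingEnd (hcpt := hcpt) (τ := τ) hτ (Matrix.single (i : Fin 2) (j : Fin 2) ((0, Pi.single w Complex.I) : mixedSpace K))) - (gardingEnd (hcpt := hcpt) (τ := τ) hτ (Matrix.single (j : Fin 2) (i : Fin 2) ((0, Pi.single w 1) : mixedSpace K)) + Complex.I • gardingEnd (hcpt := hcpt) (τ := τ) hτ (Matrix.single (j : Fin 2) (i : Fin 2) ((0, Pi.single w Complex.I) : mixedSpace K)))) v⟫_ℂ = ⟪((gardingEnd (hcpt := hcpt) (τ := τ) hτ (Matrix.single (j : Fin 2) (i : Fin 2) ((0, Pi.single w 1) : mixedSpace K)) - Complex.I • gardingEnd (hcpt := hcpt) (τ := τ) hτ (Matrix.single (j : Fin 2) (i : Fin 2) ((0, Pi.single w Complex.I) : mixedSpace K))) - (gardingEnd (hcpt := hcpt) (τ := τ) hτ (Matrix.single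 (i : Fin 2) (j : Fin 2) ((0, Pi.single w 1) : mixedSpace K)) + Complex.I • gardingEnd (hcpt := hcpt) (τ := τ) hτ (Matrix.single (i : Fin 2) (j : Fin 2) ((0, Pi.single w Complex.I) : mixedSpace K)))) u, v⟫_ℂ := by
  simp only [Submodule.coe_inner, LinearMap.sub_apply, LinearMap.add_apply, LinearMap.smul_apply,
    inner_sub_right, inner_add_right, inner_smul_right, inner_sub_left,
    inner_add_left, inner_smul_left, inner_gardingEnd_eq_neg hτ hτu, Complex.conj_I]
  ring

/-- `⟪u, P_{ij} v⟫ = -⟪P_{ji} u, v⟫`. [cite: Knapp1986, Ch. III §3] -/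
theorem inner_pPart_right (hτu : τ.IsUnitary) (i j : Fin 2) (u v : archGardingSpace hcpt τ) :
    ⟪u, ((gardingEnd (hcpt := hcpt) (τ := τ) hτ (Matrix.single (i : Fin 2) (j : Fin 2) ((0, Pi.single w 1) : mixedSpace K)) - Complex.I • gardingEnd (hcpt := hcpt) (τ := τ) hτ (Matrix.single (i : Fin 2) (j : Fin 2) ((0, Pi.single w Complex.I) : mixedSpace K))) + (gardingEnd (hcpt := hcpt) (τ := τ) hτ (Matrix.single (j : Fin 2) (i : Fin 2) ((0, Pi.single w 1) : mixedSpace K)) + Complex.I • gardingEnd (hcpt := hcpt) (τ := τ) hτ (Matrix.single (j : Fin 2) (i : Fin 2) ((0, Pi.single w Complex.I) : mixedSpace K)))) v⟫_ℂ = -⟪((gardingEnd (hcpt := hcpt) (τ := τ) hτ (Matrix.single (j : Fin 2) (i : Fin 2) ((0, Pi.single w 1) : mixedSpace K)) - Complex.I • gardingEnd (hcpt := hcpt) (τ := τ) hτ (Matrix.single (j : Fin 2) (i : Fin 2) ((0, Pi.single w Complex.I) : mixedSpace K))) + (gardingEnd (hcpt := hcpt) (τ := τ) hτ (Matrix.single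 (i : Fin 2) (j : Fin 2) ((0, Pi.single w 1) : mixedSpace K)) + Complex.I • gardingEnd (hcpt := hcpt) (τ := τ) hτ (Matrix.single (i : Fin 2) (j : Fin 2) ((0, Pi.single w Complex.I) : mixedSpace K)))) u, v⟫_ℂ := by
  simp only [Submodule.coe_inner, LinearMap.sub_apply, LinearMap.add_apply, LinearMap.smul_apply,
    inner_sub_right, inner_add_right, inner_smul_right, inner_sub_left,
    inner_add_left, inner_smul_left, inner_gardingEnd_eq_neg hτ hτu, Complex.conj_I]
  ring

/-- `⟪u, P_{ij} P_{ji} u⟫ = -‖P_{ji} u‖²`. [cite: Knapp1986, Ch. III §3] -/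
theorem inner_pPart_pPart_self (hτu : τ.IsUnitary) (i j : Fin 2) (u : archGardingSpace hcpt τ) :
    ⟪u, ((gardingEnd (hcpt := hcpt) (τ := τ) hτ (Matrix.single (i : Fin 2) (j : Fin 2) ((0, Pi.single w 1) : mixedSpace K)) - Complex.I • gardingEnd (hcpt := hcpt) (τ := τ) hτ (Matrix.single (i : Fin 2) (j : Fin 2) ((0, Pi.single w Complex.I) : mixedSpace K))) + (gardingEnd (hcpt := hcpt) (τ := τ) hτ (Matrix.single (j : Fin 2) (i : Fin 2) ((0, Pi.single w 1) : mixedSpace K)) + Complex.I • gardingEnd (hcpt := hcpt) (τ := τ) hτ (Matrix.single (j : Fin 2) (i : Fin 2) ((0, Pi.single w Complex.I) : mixedSpace K)))) (((gardingEnd (hcpt := hcpt) (τ := τ) hτ (Matrix.single (j : Fin 2) (i : Fin 2) ((0, Pi.single w 1) : mixedSpace K)) - Complex.I • gardingEnd (hcpt := hcpt) (τ := τ) hτ (Matrix.single (j : Fin 2) (i : Fin 2) ((0, Pi.single w Complex.I) : mixedSpace K))) + (gardingEnd (hcpt := hcpt) (τ := τ) hτ (Matrix.single (i : Fin 2) (j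 : Fin 2) ((0, Pi.single w 1) : mixedSpace K)) + Complex.I • gardingEnd (hcpt := hcpt) (τ := τ) hτ (Matrix.single (i : Fin 2) (j : Fin 2) ((0, Pi.single w Complex.I) : mixedSpace K)))) u)⟫_ℂ = -(((‖((gardingEnd (hcpt := hcpt) (τ := τ) hτ (Matrix.single (j : Fin 2) (i : Fin 2) ((0, Pi.single w 1) : mixedSpace K)) - Complex.I • gardingEnd (hcpt := hcpt) (τ := τ) hτ (Matrix.single (j : Fin 2) (i : Fin 2) ((0, Pi.single w Complex.I) : mixedSpace K))) + (gardingEnd (hcpt := hcpt) (τ := τ) hτ (Matrix.single (i : Fin 2) (j : Fin 2) ((0, Pi.single w 1) : mixedSpace K)) + Complex.I • gardingEnd (hcpt := hcpt) (τ := τ) hτ (Matrix.single (i : Fin 2) (j : Fin 2) ((0, Pi.single w Complex.I) : mixedSpace K)))) u‖ ^ 2 : ℝ)) : ℂ) := by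
  rw [inner_pPart_right hτ w hτu, inner_self_eq_norm_sq_to_K]
  norm_cast

/-- `⟪u, K_{ij} K_{ji} u⟫ = ‖K_{ji} u‖²`. [cite: Knapp1986, Ch. III §3] -/
theorem inner_kPart_kPart_self (hτu : τ.IsUnitary) (i j : Fin 2) (u : archGardingSpace hcpt τ) :
    ⟪u, ((gardingEnd (hcpt := hcpt) (τ := τ) hτ (Matrix.single (i : Fin 2) (j : Fin 2) ((0, Pi.single w 1) : mixedSpace K)) - Complex.I • gardingEnd (hcpt := hcpt) (τ := τ) hτ (Matrix.single (i : Fin 2) (j : Fin 2) ((0, Pi.single w Complex.I) : mixedSpace K))) - (gardingEnd (hcpt := hcpt) (τ := τ) hτ (Matrix.single (j : Fin 2) (i : Fin 2) ((0, Pi.single w 1) : mixedSpace K)) + Complex.I • gardingEnd (hcpt := hcpt) (τ := τ) hτ (Matrix.single (j : Fin 2) (i : Fin 2) ((0, Pi.single w Complex.I) : mixedSpace K)))) (((gardingEnd (hcpt := hcpt) (τ := τ) hτ (Matrix.single (j : Fin 2) (i : Fin 2) ((0, Pi.single w 1) : mixedSpace K)) - Complex.I • gardingEnd (hcpt := hcpt)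 (τ := τ) hτ (Matrix.single (j : Fin 2) (i : Fin 2) ((0, Pi.single w Complex.I) : mixedSpace K))) - (gardingEnd (hcpt := hcpt) (τ := τ) hτ (Matrix.single (i : Fin 2) (j : Fin 2) ((0, Pi.single w 1) : mixedSpace K)) + Complex.I • gardingEnd (hcpt := hcpt) (τ := τ) hτ (Matrix.single (i : Fin 2) (j : Fin 2) ((0, Pi.single w Complex.I) : mixedSpace K)))) u)⟫_ℂ = (((‖((gardingEnd (hcpt := hcpt) (τ := τ) hτ (Matrix.single (j : Fin 2) (i : Fin 2) ((0, Pi.single w 1) : mixedSpace K)) - Complex.I • gardingEnd (hcpt := hcpt) (τ := τ) hτ (Matrix.single (j : Fin 2) (i : Fin 2) ((0, Pi.single w Complex.I) : mixedSpace K))) - (gardingEnd (hcpt := hcpt) (τ := τ) hτ (Matrix.single (i : Fin 2) (j : Fin 2) ((0, Pi.single w 1) : mixedSpace K)) + Complex.I • gardingEnd (hcpt := hcpt) (τ := τ) hτ (Matrix.single (i : Fin 2) (j : Fin 2) ((0, Pi.single w Complex.I) : mixedSpace K)))) u‖ ^ 2 : ℝ)) : ℂ) := by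
  rw [inner_kPart_right hτ w hτu, inner_self_eq_norm_sq_to_K]
  norm_cast

/-- **`K_{ij} K_{ji} + P_{ij} P_{ji} = 2 τ^h(E_{ij}) τ^h(E_{ji}) + 2 τ^a(E_{ji}) τ^a(E_{ij})`** (pure algebra), so that
`Ω_𝔨 + Ω_𝔭 = 2 C^h + 2 C^a`. [cite: Knapp1986, Ch. VIII §3] -/
theorem kPart_mul_add_pPart_mul (i j : Fin 2) :
    ((gardingEnd (hcpt := hcpt) (τ := τ) hτ (Matrix.single (i : Fin 2) (j : Fin 2) ((0, Pi.single w 1) : mixedSpace K)) - Complex.I • gardingEnd (hcpt := hcpt) (τ := τ) hτ (Matrix.single (i : Fin 2) (j : Fin 2) ((0, Pi.single w Complex.I) : mixedSpace K))) - (gardingEnd (hcpt := hcpt) (τ := τ) hτ (Matrix.single (j : Fin 2) (i : Fin 2) ((0, Pi.single w 1) : mixedSpace K)) + Complex.I • gardingEnd (hcpt := hcpt) (τ := τ) hτ (Matrix.single (j : Fin 2) (i : Fin 2) ((0, Pi.single w Complex.I) : mixedSpace K)))) * ((gardingEnd (hcpt := hcpt) (τ := τ) hτ (Matrix.single (j :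 Fin 2) (i : Fin 2) ((0, Pi.single w 1) : mixedSpace K)) - Complex.I • gardingEnd (hcpt := hcpt) (τ := τ) hτ (Matrix.single (j : Fin 2) (i : Fin 2) ((0, Pi.single w Complex.I) : mixedSpace K))) - (gardingEnd (hcpt := hcpt) (τ := τ) hτ (Matrix.single (i : Fin 2) (j : Fin 2) ((0, Pi.single w 1) : mixedSpace K)) + Complex.I • gardingEnd (hcpt := hcpt) (τ := τ) hτ (Matrix.single (i : Fin 2) (j : Fin 2) ((0, Pi.single w Complex.I) : mixedSpace K)))) + ((gardingEnd (hcpt := hcpt) (τ := τ) hτ (Matrix.single (i : Fin 2) (j : Fin 2) ((0, Pi.single w 1) : mixedSpace K)) - Complex.I • gardingEnd (hcpt := hcpt) (τ := τ) hτ (Matrix.single (i : Fin 2) (j : Fin 2) ((0, Pi.single w Complex.I) : mixedSpace K))) + (gardingEnd (hcpt := hcpt) (τ := τ) hτ (Matrix.single (j : Fin 2) (i : Fin 2) ((0, Pi.single w 1) : mixedSpace K)) + Complex.I • gardingEnd (hcpt := hcpt) (τ := τ) hτ (Matrix.single (j : Fin 2) (i : Fin 2) ((0, Pi.single w Complex.I)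 : mixedSpace K)))) * ((gardingEnd (hcpt := hcpt) (τ := τ) hτ (Matrix.single (j : Fin 2) (i : Fin 2) ((0, Pi.single w 1) : mixedSpace K)) - Complex.I • gardingEnd (hcpt := hcpt) (τ := τ) hτ (Matrix.single (j : Fin 2) (i : Fin 2) ((0, Pi.single w Complex.I) : mixedSpace K))) + (gardingEnd (hcpt := hcpt) (τ := τ) hτ (Matrix.single (i : Fin 2) (j : Fin 2) ((0, Pi.single w 1) : mixedSpace K)) + Complex.I • gardingEnd (hcpt := hcpt) (τ := τ) hτ (Matrix.single (i : Fin 2) (j : Fin 2) ((0, Pi.single w Complex.I) : mixedSpace K)))) =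
      (2 : ℂ) • ((gardingEnd (hcpt := hcpt) (τ := τ) hτ (Matrix.single (i : Fin 2) (j : Fin 2) ((0, Pi.single w 1) : mixedSpace K)) - Complex.I • gardingEnd (hcpt := hcpt) (τ := τ) hτ (Matrix.single (i : Fin 2) (j : Fin 2) ((0, Pi.single w Complex.I) : mixedSpace K))) * (gardingEnd (hcpt := hcpt) (τ := τ) hτ (Matrix.single (j : Fin 2) (i : Fin 2) ((0, Pi.single w 1) : mixedSpace K)) - Complex.I • gardingEnd (hcpt := hcpt) (τ := τ) hτ (Matrix.single (j : Fin 2) (i : Fin 2) ((0, Pi.single w Complex.I) : mixedSpace K)))) + (2 : ℂ) • ((gardingEnd (hcpt := hcpt) (τ := τ) hτ (Matrix.single (j : Fin 2) (i : Fin 2) ((0, Pi.single w 1) : mixedSpace K)) + Complex.I • gardingEnd (hcpt := hcpt) (τ := τ) hτ (Matrix.single (j : Fin 2) (i : Fin 2) ((0, Pi.single w Complex.I) : mixedSpace K))) * (gardingEnd (hcpt := hcpt) (τ := τ) hτ (Matrix.single (i : Fin 2) (j : Fin 2) ((0, Pi.single w 1) : mixedSpace K)) + Complex.I • gardingEnd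 (hcpt := hcpt) (τ := τ) hτ (Matrix.single (i : Fin 2) (j : Fin 2) ((0, Pi.single w Complex.I) : mixedSpace K)))) := by
  set X : Module.End ℂ (archGardingSpace hcpt τ) := (gardingEnd (hcpt := hcpt) (τ := τ) hτ (Matrix.single (i : Fin 2) (j : Fin 2) ((0, Pi.single w 1) : mixedSpace K)) - Complex.I • gardingEnd (hcpt := hcpt) (τ := τ) hτ (Matrix.single (i : Fin 2) (j : Fin 2) ((0, Pi.single w Complex.I) : mixedSpace K)))
  set Y : Module.End ℂ (archGardingSpace hcpt τ) := (gardingEnd (hcpt := hcpt) (τ := τ) hτ (Matrix.single (j : Fin 2) (i : Fin 2) ((0, Pi.single w 1) : mixedSpace K)) - Complex.I • gardingEnd (hcpt := hcpt) (τ := τ) hτ (Matrix.single (j : Fin 2) (i : Fin 2) ((0, Pi.single w Complex.I) : mixedSpace K)))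
  set X' : Module.End ℂ (archGardingSpace hcpt τ) := (gardingEnd (hcpt := hcpt) (τ := τ) hτ (Matrix.single (j : Fin 2) (i : Fin 2) ((0, Pi.single w 1) : mixedSpace K)) + Complex.I • gardingEnd (hcpt := hcpt) (τ := τ) hτ (Matrix.single (j : Fin 2) (i : Fin 2) ((0, Pi.single w Complex.I) : mixedSpace K)))
  set Y' : Module.End ℂ (archGardingSpace hcpt τ) := (gardingEnd (hcpt := hcpt) (τ := τ) hτ (Matrix.single (i : Fin 2) (j : Fin 2) ((0, Pi.single w 1) : mixedSpace K)) + Complex.I • gardingEnd (hcpt := hcpt) (τ := τ) hτ (Matrix.single (i : Fin 2) (j : Fin 2) ((0, Pi.single w Complex.I) : mixedSpace K)))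
  simp only [sub_mul, mul_sub, add_mul, mul_add, two_smul]
  abel

/-- **`C^h - C^a = Σ P_{ij} K_{ji}`** (the holomorphic and antiholomorphic letters commute), applied to a vector:
`Σ_{ij} P_{ij} (K_{ji} v) = (λ^h - λ^a) v`. [cite: Knapp1986, Ch. VIII §3] -/
theorem sum_pPart_kPart_apply {lama lamh : ℂ} (v : archGardingSpace hcpt τ)
    (hCa : ∑ i : Fin 2, ∑ j : Fin 2, (gardingEnd (hcpt := hcpt) (τ := τ) hτ (Matrix.single (i : Fin 2) (j : Fin 2) ((0, Pi.single w 1) : mixedSpace K)) + Complex.I • gardingEnd (hcpt := hcpt) (τ := τ) hτ (Matrix.single (i : Fin 2) (j : Fin 2) ((0, Pi.single w Complex.I) : mixedSpace K))) ((gardingEnd (hcpt := hcpt) (τ := τ) hτ (Matrix.single (j : Fin 2) (i : Fin 2) ((0, Pi.single w 1) : mixedSpace K)) + Complex.I • gardingEnd (hcpt := hcpt) (τ := τ) hτ (Matrix.single (j : Fin 2) (i : Fin 2) ((0, Pi.single w Complex.I) : mixedSpace K))) v) = lama • v)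
    (hCh : ∑ i : Fin 2, ∑ j : Fin 2, (gardingEnd (hcpt := hcpt) (τ := τ) hτ (Matrix.single (i : Fin 2) (j : Fin 2) ((0, Pi.single w 1) : mixedSpace K)) - Complex.I • gardingEnd (hcpt := hcpt) (τ := τ) hτ (Matrix.single (i : Fin 2) (j : Fin 2) ((0, Pi.single w Complex.I) : mixedSpace K))) ((gardingEnd (hcpt := hcpt) (τ := τ) hτ (Matrix.single (j : Fin 2) (i : Fin 2) ((0, Pi.single w 1) : mixedSpace K)) - Complex.I • gardingEnd (hcpt := hcpt) (τ := τ) hτ (Matrix.single (j : Fin 2) (i : Fin 2) ((0, Pi.single w Complex.I) : mixedSpace K))) v) = lamh • v) :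
    ((gardingEnd (hcpt := hcpt) (τ := τ) hτ (Matrix.single (0 : Fin 2) (0 : Fin 2) ((0, Pi.single w 1) : mixedSpace K)) - Complex.I • gardingEnd (hcpt := hcpt) (τ := τ) hτ (Matrix.single (0 : Fin 2) (0 : Fin 2) ((0, Pi.single w Complex.I) : mixedSpace K))) + (gardingEnd (hcpt := hcpt) (τ := τ) hτ (Matrix.single (0 : Fin 2) (0 : Fin 2) ((0, Pi.single w 1) : mixedSpace K)) + Complex.I • gardingEnd (hcpt := hcpt) (τ := τ) hτ (Matrix.single (0 : Fin 2) (0 : Fin 2) ((0, Pi.single w Complex.I) : mixedSpace K)))) (((gardingEnd (hcpt := hcpt) (τ := τ) hτ (Matrix.single (0 : Fin 2) (0 : Fin 2) ((0, Pi.single w 1) : mixedSpace K)) - Complex.I • gardingEnd (hcpt := hcpt) (τ := τ) hτ (Matrix.single (0 : Fin 2) (0 : Fin 2) ((0, Pi.single w Complex.I) : mixedSpace K))) - (gardingEnd (hcpt := hcpt) (τ := τ) hτ (Matrix.single (0 : Fin 2) (0 : Fin 2) ((0, Pi.single w 1) : mixedSpace K)) + Complex.I • gardingEnd (hcpt :=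 hcpt) (τ := τ) hτ (Matrix.single (0 : Fin 2) (0 : Fin 2) ((0, Pi.single w Complex.I) : mixedSpace K)))) v) + ((gardingEnd (hcpt := hcpt) (τ := τ) hτ (Matrix.single (0 : Fin 2) (1 : Fin 2) ((0, Pi.single w 1) : mixedSpace K)) - Complex.I • gardingEnd (hcpt := hcpt) (τ := τ) hτ (Matrix.single (0 : Fin 2) (1 : Fin 2) ((0, Pi.single w Complex.I) : mixedSpace K))) + (gardingEnd (hcpt := hcpt) (τ := τ) hτ (Matrix.single (1 : Fin 2) (0 : Fin 2) ((0, Pi.single w 1) : mixedSpace K)) + Complex.I • gardingEnd (hcpt := hcpt) (τ := τ) hτ (Matrix.single (1 : Fin 2) (0 : Fin 2) ((0, Pi.single w Complex.I) : mixedSpace K)))) (((gardingEnd (hcpt := hcpt) (τ := τ) hτ (Matrix.single (1 : Fin 2) (0 : Fin 2) ((0, Pi.single w 1) : mixedSpace K)) - Complex.I • gardingEnd (hcpt := hcpt) (τ := τ) hτ (Matrix.single (1 : Fin 2) (0 : Fin 2) ((0, Pi.single w Complex.I) : mixedSpace K))) - (gardingEnd (hcpt := hcpt) (τ := τ) hτ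 (Matrix.single (0 : Fin 2) (1 : Fin 2) ((0, Pi.single w 1) : mixedSpace K)) + Complex.I • gardingEnd (hcpt := hcpt) (τ := τ) hτ (Matrix.single (0 : Fin 2) (1 : Fin 2) ((0, Pi.single w Complex.I) : mixedSpace K)))) v) +
      ((gardingEnd (hcpt := hcpt) (τ := τ) hτ (Matrix.single (1 : Fin 2) (0 : Fin 2) ((0, Pi.single w 1) : mixedSpace K)) - Complex.I • gardingEnd (hcpt := hcpt) (τ := τ) hτ (Matrix.single (1 : Fin 2) (0 : Fin 2) ((0, Pi.single w Complex.I) : mixedSpace K))) + (gardingEnd (hcpt := hcpt) (τ := τ) hτ (Matrix.single (0 : Fin 2) (1 : Fin 2) ((0, Pi.single w 1) : mixedSpace K)) + Complex.I • gardingEnd (hcpt := hcpt) (τ := τ) hτ (Matrix.single (0 : Fin 2) (1 : Fin 2) ((0, Pi.single w Complex.I) : mixedSpace K)))) (((gardingEnd (hcpt := hcpt) (τ := τ) hτ (Matrix.single (0 : Fin 2) (1 : Fin 2) ((0, Pi.single w 1) : mixedSpace K)) - Complex.I • gardingEnd (hcpt := hcpt) (τ := τ) hτ (Matrix.single (0 :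 Fin 2) (1 : Fin 2) ((0, Pi.single w Complex.I) : mixedSpace K))) - (gardingEnd (hcpt := hcpt) (τ := τ) hτ (Matrix.single (1 : Fin 2) (0 : Fin 2) ((0, Pi.single w 1) : mixedSpace K)) + Complex.I • gardingEnd (hcpt := hcpt) (τ := τ) hτ (Matrix.single (1 : Fin 2) (0 : Fin 2) ((0, Pi.single w Complex.I) : mixedSpace K)))) v) + ((gardingEnd (hcpt := hcpt) (τ := τ) hτ (Matrix.single (1 : Fin 2) (1 : Fin 2) ((0, Pi.single w 1) : mixedSpace K)) - Complex.I • gardingEnd (hcpt := hcpt) (τ := τ) hτ (Matrix.single (1 : Fin 2) (1 : Fin 2) ((0, Pi.single w Complex.I) : mixedSpace K))) + (gardingEnd (hcpt := hcpt) (τ := τ) hτ (Matrix.single (1 : Fin 2) (1 : Fin 2) ((0, Pi.single w 1) : mixedSpace K)) + Complex.I • gardingEnd (hcpt := hcpt) (τ := τ) hτ (Matrix.single (1 : Fin 2) (1 : Fin 2) ((0, Pi.single w Complex.I) : mixedSpace K)))) (((gardingEnd (hcpt := hcpt) (τ := τ) hτ (Matrix.single (1 : Fin 2) (1 : Fin 2)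 ((0, Pi.single w 1) : mixedSpace K)) - Complex.I • gardingEnd (hcpt := hcpt) (τ := τ) hτ (Matrix.single (1 : Fin 2) (1 : Fin 2) ((0, Pi.single w Complex.I) : mixedSpace K))) - (gardingEnd (hcpt := hcpt) (τ := τ) hτ (Matrix.single (1 : Fin 2) (1 : Fin 2) ((0, Pi.single w 1) : mixedSpace K)) + Complex.I • gardingEnd (hcpt := hcpt) (τ := τ) hτ (Matrix.single (1 : Fin 2) (1 : Fin 2) ((0, Pi.single w Complex.I) : mixedSpace K)))) v) = (lamh - lama) • v := by
  simp only [Fin.sum_univ_two] at hCa hCh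
  have c00 := gardingEndHol_comm_gardingEndAnti hτ w 0 0 0 0
  have c01 := gardingEndHol_comm_gardingEndAnti hτ w 0 1 0 1
  have c10 := gardingEndHol_comm_gardingEndAnti hτ w 1 0 1 0
  have c11 := gardingEndHol_comm_gardingEndAnti hτ w 1 1 1 1
  set Ph : Module.End ℂ (archGardingSpace hcpt τ) := (gardingEnd (hcpt := hcpt) (τ := τ) hτ (Matrix.single (0 : Fin 2) (1 : Fin 2) ((0, Pi.single w 1) : mixedSpace K)) - Complex.I • gardingEnd (hcpt := hcpt) (τ := τ) hτ (Matrix.single (0 : Fin 2) (1 : Fin 2) ((0, Pi.single w Complex.I) : mixedSpace K)))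
  set Mh : Module.End ℂ (archGardingSpace hcpt τ) := (gardingEnd (hcpt := hcpt) (τ := τ) hτ (Matrix.single (1 : Fin 2) (0 : Fin 2) ((0, Pi.single w 1) : mixedSpace K)) - Complex.I • gardingEnd (hcpt := hcpt) (τ := τ) hτ (Matrix.single (1 : Fin 2) (0 : Fin 2) ((0, Pi.single w Complex.I) : mixedSpace K)))
  set Pa : Module.End ℂ (archGardingSpace hcpt τ) := (gardingEnd (hcpt := hcpt) (τ := τ) hτ (Matrix.single (0 : Fin 2) (1 : Fin 2) ((0, Pi.single w 1) : mixedSpace K)) + Complex.I • gardingEnd (hcpt := hcpt) (τ := τ) hτ (Matrix.single (0 : Fin 2) (1 : Fin 2) ((0, Pi.single w Complex.I) : mixedSpace K)))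
  set Ma : Module.End ℂ (archGardingSpace hcpt τ) := (gardingEnd (hcpt := hcpt) (τ := τ) hτ (Matrix.single (1 : Fin 2) (0 : Fin 2) ((0, Pi.single w 1) : mixedSpace K)) + Complex.I • gardingEnd (hcpt := hcpt) (τ := τ) hτ (Matrix.single (1 : Fin 2) (0 : Fin 2) ((0, Pi.single w Complex.I) : mixedSpace K)))
  set Hh0 : Module.End ℂ (archGardingSpace hcpt τ) := (gardingEnd (hcpt := hcpt) (τ := τ) hτ (Matrix.single (0 : Fin 2) (0 : Fin 2) ((0, Pi.single w 1) : mixedSpace K)) - Complex.I • gardingEnd (hcpt := hcpt) (τ := τ) hτ (Matrix.single (0 : Fin 2) (0 : Fin 2) ((0, Pi.single w Complex.I) : mixedSpace K)))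
  set Hh1 : Module.End ℂ (archGardingSpace hcpt τ) := (gardingEnd (hcpt := hcpt) (τ := τ) hτ (Matrix.single (1 : Fin 2) (1 : Fin 2) ((0, Pi.single w 1) : mixedSpace K)) - Complex.I • gardingEnd (hcpt := hcpt) (τ := τ) hτ (Matrix.single (1 : Fin 2) (1 : Fin 2) ((0, Pi.single w Complex.I) : mixedSpace K)))
  set Ha0 : Module.End ℂ (archGardingSpace hcpt τ) := (gardingEnd (hcpt := hcpt) (τ := τ) hτ (Matrix.single (0 : Fin 2) (0 : Fin 2) ((0, Pi.single w 1) : mixedSpace K)) + Complex.I • gardingEnd (hcpt := hcpt) (τ := τ) hτ (Matrix.single (0 : Fin 2) (0 : Fin 2) ((0, Pi.single w Complex.I) : mixedSpace K)))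
  set Ha1 : Module.End ℂ (archGardingSpace hcpt τ) := (gardingEnd (hcpt := hcpt) (τ := τ) hτ (Matrix.single (1 : Fin 2) (1 : Fin 2) ((0, Pi.single w 1) : mixedSpace K)) + Complex.I • gardingEnd (hcpt := hcpt) (τ := τ) hτ (Matrix.single (1 : Fin 2) (1 : Fin 2) ((0, Pi.single w Complex.I) : mixedSpace K)))
  have d00 : Hh0 (Ha0 v) = Ha0 (Hh0 v) := by rw [← Module.End.mul_apply, c00, Module.End.mul_apply]
  have d01 : Ph (Pa v) = Pa (Ph v) := by rw [← Module.End.mul_apply, c01, Module.End.mul_apply]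
  have d10 : Mh (Ma v) = Ma (Mh v) := by rw [← Module.End.mul_apply, c10, Module.End.mul_apply]
  have d11 : Hh1 (Ha1 v) = Ha1 (Hh1 v) := by rw [← Module.End.mul_apply, c11, Module.End.mul_apply]
  simp only [LinearMap.add_apply, LinearMap.sub_apply, map_sub]
  rw [sub_smul, ← hCa, ← hCh, d00, d01, d10, d11]
  abel

/-- **`[K₀₁, P₁₀] = 2 (P₀₀ - P₁₁)`** (`[τ^h(E₀₁), τ^h(E₁₀)] = 2(τ^h(E₀₀) - τ^h(E₁₁))` and the antiholomorphic
analogue). [cite: Knapp1986, Ch. VIII §3] -/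
theorem kPart01_mul_pPart10 :
    ((gardingEnd (hcpt := hcpt) (τ := τ) hτ (Matrix.single (0 : Fin 2) (1 : Fin 2) ((0, Pi.single w 1) : mixedSpace K)) - Complex.I • gardingEnd (hcpt := hcpt) (τ := τ) hτ (Matrix.single (0 : Fin 2) (1 : Fin 2) ((0, Pi.single w Complex.I) : mixedSpace K))) - (gardingEnd (hcpt := hcpt) (τ := τ) hτ (Matrix.single (1 : Fin 2) (0 : Fin 2) ((0, Pi.single w 1) : mixedSpace K)) + Complex.I • gardingEnd (hcpt := hcpt) (τ := τ) hτ (Matrix.single (1 : Fin 2) (0 : Fin 2) ((0, Pi.single w Complex.I) : mixedSpace K)))) * ((gardingEnd (hcpt := hcpt) (τ := τ) hτ (Matrix.single (1 : Fin 2) (0 : Fin 2) ((0, Pi.single w 1) : mixedSpace K)) - Complex.I • gardingEnd (hcpt := hcpt) (τ := τ) hτ (Matrix.single (1 : Fin 2) (0 : Fin 2) ((0, Pi.single w Complex.I) : mixedSpace K))) + (gardingEnd (hcpt := hcpt) (τ := τ) hτ (Matrix.single (0 : Fin 2) (1 : Fin 2) ((0, Pi.single w 1) : mixedSpace K)) +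 Complex.I • gardingEnd (hcpt := hcpt) (τ := τ) hτ (Matrix.single (0 : Fin 2) (1 : Fin 2) ((0, Pi.single w Complex.I) : mixedSpace K)))) = ((gardingEnd (hcpt := hcpt) (τ := τ) hτ (Matrix.single (1 : Fin 2) (0 : Fin 2) ((0, Pi.single w 1) : mixedSpace K)) - Complex.I • gardingEnd (hcpt := hcpt) (τ := τ) hτ (Matrix.single (1 : Fin 2) (0 : Fin 2) ((0, Pi.single w Complex.I) : mixedSpace K))) + (gardingEnd (hcpt := hcpt) (τ := τ) hτ (Matrix.single (0 : Fin 2) (1 : Fin 2) ((0, Pi.single w 1) : mixedSpace K)) + Complex.I • gardingEnd (hcpt := hcpt) (τ := τ) hτ (Matrix.single (0 : Fin 2) (1 : Fin 2) ((0, Pi.single w Complex.I) : mixedSpace K)))) * ((gardingEnd (hcpt := hcpt) (τ := τ) hτ (Matrix.single (0 : Fin 2) (1 : Fin 2) ((0, Pi.single w 1) : mixedSpace K)) - Complex.I • gardingEnd (hcpt := hcpt) (τ := τ) hτ (Matrix.single (0 : Fin 2) (1 : Fin 2) ((0, Pi.single w Complex.I) : mixedSpace K))) - (gardingEnd (hcpt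 := hcpt) (τ := τ) hτ (Matrix.single (1 : Fin 2) (0 : Fin 2) ((0, Pi.single w 1) : mixedSpace K)) + Complex.I • gardingEnd (hcpt := hcpt) (τ := τ) hτ (Matrix.single (1 : Fin 2) (0 : Fin 2) ((0, Pi.single w Complex.I) : mixedSpace K)))) +
      (2 : ℂ) • (((gardingEnd (hcpt := hcpt) (τ := τ) hτ (Matrix.single (0 : Fin 2) (0 : Fin 2) ((0, Pi.single w 1) : mixedSpace K)) - Complex.I • gardingEnd (hcpt := hcpt) (τ := τ) hτ (Matrix.single (0 : Fin 2) (0 : Fin 2) ((0, Pi.single w Complex.I) : mixedSpace K))) + (gardingEnd (hcpt := hcpt) (τ := τ) hτ (Matrix.single (0 : Fin 2) (0 : Fin 2) ((0, Pi.single w 1) : mixedSpace K)) + Complex.I • gardingEnd (hcpt := hcpt) (τ := τ) hτ (Matrix.single (0 : Fin 2) (0 : Fin 2) ((0, Pi.single w Complex.I) : mixedSpace K)))) - ((gardingEnd (hcpt := hcpt) (τ := τ) hτ (Matrix.single (1 : Fin 2) (1 : Fin 2) ((0, Pi.single w 1) : mixedSpace K)) - Complex.I • gardingEnd (hcpt :=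 hcpt) (τ := τ) hτ (Matrix.single (1 : Fin 2) (1 : Fin 2) ((0, Pi.single w Complex.I) : mixedSpace K))) + (gardingEnd (hcpt := hcpt) (τ := τ) hτ (Matrix.single (1 : Fin 2) (1 : Fin 2) ((0, Pi.single w 1) : mixedSpace K)) + Complex.I • gardingEnd (hcpt := hcpt) (τ := τ) hτ (Matrix.single (1 : Fin 2) (1 : Fin 2) ((0, Pi.single w Complex.I) : mixedSpace K))))) := by
  have hh : (gardingEnd (hcpt := hcpt) (τ := τ) hτ (Matrix.single (0 : Fin 2) (1 : Fin 2) ((0, Pi.single w 1) : mixedSpace K)) - Complex.I • gardingEnd (hcpt := hcpt) (τ := τ) hτ (Matrix.single (0 : Fin 2) (1 : Fin 2) ((0, Pi.single w Complex.I) : mixedSpace K))) * (gardingEnd (hcpt := hcpt) (τ := τ) hτ (Matrix.single (1 : Fin 2) (0 : Fin 2) ((0, Pi.single w 1) : mixedSpace K)) - Complex.I • gardingEnd (hcpt := hcpt) (τ := τ) hτ (Matrix.single (1 : Fin 2) (0 : Fin 2) ((0, Pi.single w Complex.I) : mixedSpace K))) - (gardingEnd (hcpt := hcpt) (τ := τ)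 hτ (Matrix.single (1 : Fin 2) (0 : Fin 2) ((0, Pi.single w 1) : mixedSpace K)) - Complex.I • gardingEnd (hcpt := hcpt) (τ := τ) hτ (Matrix.single (1 : Fin 2) (0 : Fin 2) ((0, Pi.single w Complex.I) : mixedSpace K))) * (gardingEnd (hcpt := hcpt) (τ := τ) hτ (Matrix.single (0 : Fin 2) (1 : Fin 2) ((0, Pi.single w 1) : mixedSpace K)) - Complex.I • gardingEnd (hcpt := hcpt) (τ := τ) hτ (Matrix.single (0 : Fin 2) (1 : Fin 2) ((0, Pi.single w Complex.I) : mixedSpace K))) = (2 : ℂ) • ((gardingEnd (hcpt := hcpt) (τ := τ) hτ (Matrix.single (0 : Fin 2) (0 : Fin 2) ((0, Pi.single w 1) : mixedSpace K)) - Complex.I • gardingEnd (hcpt := hcpt) (τ := τ) hτ (Matrix.single (0 : Fin 2) (0 : Fin 2) ((0, Pi.single w Complex.I) : mixedSpace K))) - (gardingEnd (hcpt := hcpt) (τ := τ) hτ (Matrix.single (1 : Fin 2) (1 : Fin 2) ((0, Pi.single w 1) : mixedSpace K)) - Complex.I • gardingEnd (hcpt := hcpt) (τ := τ) hτ (Matrix.single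 (1 : Fin 2) (1 : Fin 2) ((0, Pi.single w Complex.I) : mixedSpace K)))) := gardingEndHol_xPlus_comm_xMinus hτ w
  have ha : (gardingEnd (hcpt := hcpt) (τ := τ) hτ (Matrix.single (0 : Fin 2) (1 : Fin 2) ((0, Pi.single w 1) : mixedSpace K)) + Complex.I • gardingEnd (hcpt := hcpt) (τ := τ) hτ (Matrix.single (0 : Fin 2) (1 : Fin 2) ((0, Pi.single w Complex.I) : mixedSpace K))) * (gardingEnd (hcpt := hcpt) (τ := τ) hτ (Matrix.single (1 : Fin 2) (0 : Fin 2) ((0, Pi.single w 1) : mixedSpace K)) + Complex.I • gardingEnd (hcpt := hcpt) (τ := τ) hτ (Matrix.single (1 : Fin 2) (0 : Fin 2) ((0, Pi.single w Complex.I) : mixedSpace K))) - (gardingEnd (hcpt := hcpt) (τ := τ) hτ (Matrix.single (1 : Fin 2) (0 : Fin 2) ((0, Pi.single w 1) : mixedSpace K)) + Complex.I • gardingEnd (hcpt := hcpt) (τ := τ) hτ (Matrix.single (1 : Fin 2) (0 : Fin 2) ((0, Pi.single w Complex.I) : mixedSpace K))) * (gardingEnd (hcpt := hcpt) (τ :=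 τ) hτ (Matrix.single (0 : Fin 2) (1 : Fin 2) ((0, Pi.single w 1) : mixedSpace K)) + Complex.I • gardingEnd (hcpt := hcpt) (τ := τ) hτ (Matrix.single (0 : Fin 2) (1 : Fin 2) ((0, Pi.single w Complex.I) : mixedSpace K))) = (2 : ℂ) • ((gardingEnd (hcpt := hcpt) (τ := τ) hτ (Matrix.single (0 : Fin 2) (0 : Fin 2) ((0, Pi.single w 1) : mixedSpace K)) + Complex.I • gardingEnd (hcpt := hcpt) (τ := τ) hτ (Matrix.single (0 : Fin 2) (0 : Fin 2) ((0, Pi.single w Complex.I) : mixedSpace K))) - (gardingEnd (hcpt := hcpt) (τ := τ) hτ (Matrix.single (1 : Fin 2) (1 : Fin 2) ((0, Pi.single w 1) : mixedSpace K)) + Complex.I • gardingEnd (hcpt := hcpt) (τ := τ) hτ (Matrix.single (1 : Fin 2) (1 : Fin 2) ((0, Pi.single w Complex.I) : mixedSpace K)))) := gardingEndAnti_xPlus_comm_xMinus hτ w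
  have c1 : (gardingEnd (hcpt := hcpt) (τ := τ) hτ (Matrix.single (0 : Fin 2) (1 : Fin 2) ((0, Pi.single w 1) : mixedSpace K)) - Complex.I • gardingEnd (hcpt := hcpt) (τ := τ) hτ (Matrix.single (0 : Fin 2) (1 : Fin 2) ((0, Pi.single w Complex.I) : mixedSpace K))) * (gardingEnd (hcpt := hcpt) (τ := τ) hτ (Matrix.single (0 : Fin 2) (1 : Fin 2) ((0, Pi.single w 1) : mixedSpace K)) + Complex.I • gardingEnd (hcpt := hcpt) (τ := τ) hτ (Matrix.single (0 : Fin 2) (1 : Fin 2) ((0, Pi.single w Complex.I) : mixedSpace K))) = (gardingEnd (hcpt := hcpt) (τ := τ) hτ (Matrix.single (0 : Fin 2) (1 : Fin 2) ((0, Pi.single w 1) : mixedSpace K)) + Complex.I • gardingEnd (hcpt := hcpt) (τ := τ) hτ (Matrix.single (0 : Fin 2) (1 : Fin 2) ((0, Pi.single w Complex.I) : mixedSpace K))) * (gardingEnd (hcpt := hcpt) (τ := τ) hτ (Matrix.single (0 : Fin 2) (1 : Fin 2) ((0, Pi.single w 1) : mixedSpace K)) - Complex.I • gardingEnd (hcpt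 := hcpt) (τ := τ) hτ (Matrix.single (0 : Fin 2) (1 : Fin 2) ((0, Pi.single w Complex.I) : mixedSpace K))) := gardingEndHol_comm_gardingEndAnti hτ w 0 1 0 1
  have c2 : (gardingEnd (hcpt := hcpt) (τ := τ) hτ (Matrix.single (1 : Fin 2) (0 : Fin 2) ((0, Pi.single w 1) : mixedSpace K)) - Complex.I • gardingEnd (hcpt := hcpt) (τ := τ) hτ (Matrix.single (1 : Fin 2) (0 : Fin 2) ((0, Pi.single w Complex.I) : mixedSpace K))) * (gardingEnd (hcpt := hcpt) (τ := τ) hτ (Matrix.single (1 : Fin 2) (0 : Fin 2) ((0, Pi.single w 1) : mixedSpace K)) + Complex.I • gardingEnd (hcpt := hcpt) (τ := τ) hτ (Matrix.single (1 : Fin 2) (0 : Fin 2) ((0, Pi.single w Complex.I) : mixedSpace K))) = (gardingEnd (hcpt := hcpt) (τ := τ) hτ (Matrix.single (1 : Fin 2) (0 : Fin 2) ((0, Pi.single w 1) : mixedSpace K)) + Complex.I • gardingEnd (hcpt := hcpt) (τ := τ) hτ (Matrix.single (1 : Fin 2) (0 : Fin 2) ((0, Pi.single w Complex.I) : mixedSpace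 K))) * (gardingEnd (hcpt := hcpt) (τ := τ) hτ (Matrix.single (1 : Fin 2) (0 : Fin 2) ((0, Pi.single w 1) : mixedSpace K)) - Complex.I • gardingEnd (hcpt := hcpt) (τ := τ) hτ (Matrix.single (1 : Fin 2) (0 : Fin 2) ((0, Pi.single w Complex.I) : mixedSpace K))) := gardingEndHol_comm_gardingEndAnti hτ w 1 0 1 0
  set Ph : Module.End ℂ (archGardingSpace hcpt τ) := (gardingEnd (hcpt := hcpt) (τ := τ) hτ (Matrix.single (0 : Fin 2) (1 : Fin 2) ((0, Pi.single w 1) : mixedSpace K)) - Complex.I • gardingEnd (hcpt := hcpt) (τ := τ) hτ (Matrix.single (0 : Fin 2) (1 : Fin 2) ((0, Pi.single w Complex.I) : mixedSpace K)))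
  set Mh : Module.End ℂ (archGardingSpace hcpt τ) := (gardingEnd (hcpt := hcpt) (τ := τ) hτ (Matrix.single (1 : Fin 2) (0 : Fin 2) ((0, Pi.single w 1) : mixedSpace K)) - Complex.I • gardingEnd (hcpt := hcpt) (τ := τ) hτ (Matrix.single (1 : Fin 2) (0 : Fin 2) ((0, Pi.single w Complex.I) : mixedSpace K)))
  set Pa : Module.End ℂ (archGardingSpace hcpt τ) := (gardingEnd (hcpt := hcpt) (τ := τ) hτ (Matrix.single (0 : Fin 2) (1 : Fin 2) ((0, Pi.single w 1) : mixedSpace K)) + Complex.I • gardingEnd (hcpt := hcpt) (τ := τ) hτ (Matrix.single (0 : Fin 2) (1 : Fin 2) ((0, Pi.single w Complex.I) : mixedSpace K)))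
  set Ma : Module.End ℂ (archGardingSpace hcpt τ) := (gardingEnd (hcpt := hcpt) (τ := τ) hτ (Matrix.single (1 : Fin 2) (0 : Fin 2) ((0, Pi.single w 1) : mixedSpace K)) + Complex.I • gardingEnd (hcpt := hcpt) (τ := τ) hτ (Matrix.single (1 : Fin 2) (0 : Fin 2) ((0, Pi.single w Complex.I) : mixedSpace K)))
  set Hh : Module.End ℂ (archGardingSpace hcpt τ) := (gardingEnd (hcpt := hcpt) (τ := τ) hτ (Matrix.single (0 : Fin 2) (0 : Fin 2) ((0, Pi.single w 1) : mixedSpace K)) - Complex.I • gardingEnd (hcpt := hcpt) (τ := τ) hτ (Matrix.single (0 : Fin 2) (0 : Fin 2) ((0, Pi.single w Complex.I) : mixedSpace K))) - (gardingEnd (hcpt := hcpt) (τ := τ) hτ (Matrix.single (1 : Fin 2) (1 : Fin 2) ((0, Pi.single w 1) : mixedSpace K)) - Complex.I • gardingEnd (hcpt := hcpt) (τ := τ) hτ (Matrix.single (1 : Fin 2) (1 : Fin 2) ((0, Pi.single w Complex.I) : mixedSpace K)))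
  set Ha : Module.End ℂ (archGardingSpace hcpt τ) := (gardingEnd (hcpt := hcpt) (τ := τ) hτ (Matrix.single (0 : Fin 2) (0 : Fin 2) ((0, Pi.single w 1) : mixedSpace K)) + Complex.I • gardingEnd (hcpt := hcpt) (τ := τ) hτ (Matrix.single (0 : Fin 2) (0 : Fin 2) ((0, Pi.single w Complex.I) : mixedSpace K))) - (gardingEnd (hcpt := hcpt) (τ := τ) hτ (Matrix.single (1 : Fin 2) (1 : Fin 2) ((0, Pi.single w 1) : mixedSpace K)) + Complex.I • gardingEnd (hcpt := hcpt) (τ := τ) hτ (Matrix.single (1 : Fin 2) (1 : Fin 2) ((0, Pi.single w Complex.I) : mixedSpace K)))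
  have hh' : Ph * Mh = Mh * Ph + (2 : ℂ) • Hh := by rw [← hh]; abel
  have ha' : Pa * Ma = Ma * Pa + (2 : ℂ) • Ha := by rw [← ha]; abel
  have e : ((gardingEnd (hcpt := hcpt) (τ := τ) hτ (Matrix.single (0 : Fin 2) (0 : Fin 2) ((0, Pi.single w 1) : mixedSpace K)) - Complex.I • gardingEnd (hcpt := hcpt) (τ := τ) hτ (Matrix.single (0 : Fin 2) (0 : Fin 2) ((0, Pi.single w Complex.I) : mixedSpace K))) + (gardingEnd (hcpt := hcpt) (τ := τ) hτ (Matrix.single (0 : Fin 2) (0 : Fin 2) ((0, Pi.single w 1) : mixedSpace K)) + Complex.I • gardingEnd (hcpt := hcpt) (τ := τ) hτ (Matrix.single (0 : Fin 2) (0 : Fin 2) ((0, Pi.single w Complex.I) : mixedSpace K)))) - ((gardingEnd (hcpt := hcpt) (τ := τ) hτ (Matrix.single (1 : Fin 2) (1 : Fin 2) ((0, Pi.single w 1) : mixedSpace K)) - Complex.I • gardingEnd (hcpt := hcpt) (τ := τ) hτ (Matrix.single (1 : Fin 2) (1 : Fin 2) ((0, Pi.single w Complex.I) : mixedSpace K)))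 + (gardingEnd (hcpt := hcpt) (τ := τ) hτ (Matrix.single (1 : Fin 2) (1 : Fin 2) ((0, Pi.single w 1) : mixedSpace K)) + Complex.I • gardingEnd (hcpt := hcpt) (τ := τ) hτ (Matrix.single (1 : Fin 2) (1 : Fin 2) ((0, Pi.single w Complex.I) : mixedSpace K)))) = Hh + Ha := by
    simp only [Hh, Ha]; abel
  rw [e]
  simp only [sub_mul, mul_sub, add_mul, mul_add]
  rw [hh', ha', c1, c2]
  module

/-! ### 4. A highest-weight vector of torus weight `m`: eigen-data and the bound `|im ν| ≤ (m+2)/2` -/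

/-- **Eigen-data of a highest-weight vector** `y` (`E y = 0`, `τ(T) y = im y`): `K₀₀ y = (m - iμ₂) y`,
`K₁₁ y = (-m - iμ₂) y`, `(P₀₀ + P₁₁) y = 2μ₁ y`, `E (F y) = 4m y`. [cite: Knapp1986, Ch. II §5, Ch. VIII §3] -/
theorem highest_kPart_apply {μ₁ μ₂ : ℂ} {m : ℕ}
    (hZ1 : ∀ v : archGardingSpace hcpt τ, gardingEnd (hcpt := hcpt) (τ := τ) hτ (Matrix.single 0 0 ((0, Pi.single w 1) : mixedSpace K) + Matrix.single 1 1 ((0, Pi.single w 1) : mixedSpace K)) v = μ₁ • v)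
    (hZ2 : ∀ v : archGardingSpace hcpt τ, gardingEnd (hcpt := hcpt) (τ := τ) hτ (Matrix.single (0 : Fin 2) (0 : Fin 2) ((0, Pi.single w Complex.I) : mixedSpace K) + Matrix.single (1 : Fin 2) (1 : Fin 2) ((0, Pi.single w Complex.I) : mixedSpace K)) v = μ₂ • v)
    {y : archGardingSpace hcpt τ} (hE : ((gardingEnd (hcpt := hcpt) (τ := τ) hτ (Matrix.single (0 : Fin 2) (1 : Fin 2) ((0, Pi.single w 1) : mixedSpace K)) - Complex.I • gardingEnd (hcpt := hcpt) (τ := τ) hτ (Matrix.single (0 : Fin 2) (1 : Fin 2) ((0, Pi.single w Complex.I) : mixedSpace K))) - (gardingEnd (hcpt := hcpt) (τ := τ) hτ (Matrix.single (1 : Fin 2) (0 : Fin 2) ((0, Pi.single w 1) : mixedSpace K)) + Complex.I • gardingEnd (hcpt := hcpt) (τ := τ) hτ (Matrix.single (1 : Fin 2) (0 : Fin 2) ((0, Pi.single w Complex.I) : mixedSpace K)))) y = 0) (hT : gardingEnd (hcpt := hcpt) (τ := τ) hτ (Matrix.single (0 : Fin 2) (0 : Fin 2) ((0, Pi.single w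 Complex.I) : mixedSpace K) - Matrix.single (1 : Fin 2) (1 : Fin 2) ((0, Pi.single w Complex.I) : mixedSpace K)) y = (Complex.I * m) • y) :
    ((gardingEnd (hcpt := hcpt) (τ := τ) hτ (Matrix.single (0 : Fin 2) (0 : Fin 2) ((0, Pi.single w 1) : mixedSpace K)) - Complex.I • gardingEnd (hcpt := hcpt) (τ := τ) hτ (Matrix.single (0 : Fin 2) (0 : Fin 2) ((0, Pi.single w Complex.I) : mixedSpace K))) - (gardingEnd (hcpt := hcpt) (τ := τ) hτ (Matrix.single (0 : Fin 2) (0 : Fin 2) ((0, Pi.single w 1) : mixedSpace K)) + Complex.I • gardingEnd (hcpt := hcpt) (τ := τ) hτ (Matrix.single (0 : Fin 2) (0 : Fin 2) ((0, Pi.single w Complex.I) : mixedSpace K)))) y = ((m : ℂ) - Complex.I * μ₂) • y ∧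
    ((gardingEnd (hcpt := hcpt) (τ := τ) hτ (Matrix.single (1 : Fin 2) (1 : Fin 2) ((0, Pi.single w 1) : mixedSpace K)) - Complex.I • gardingEnd (hcpt := hcpt) (τ := τ) hτ (Matrix.single (1 : Fin 2) (1 : Fin 2) ((0, Pi.single w Complex.I) : mixedSpace K))) - (gardingEnd (hcpt := hcpt) (τ := τ) hτ (Matrix.single (1 : Fin 2) (1 : Fin 2) ((0, Pi.single w 1) : mixedSpace K)) + Complex.I • gardingEnd (hcpt := hcpt) (τ := τ) hτ (Matrix.single (1 : Fin 2) (1 : Fin 2) ((0, Pi.single w Complex.I) : mixedSpace K)))) y = (-(m : ℂ) - Complex.I * μ₂) • y ∧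
    ((gardingEnd (hcpt := hcpt) (τ := τ) hτ (Matrix.single (0 : Fin 2) (0 : Fin 2) ((0, Pi.single w 1) : mixedSpace K)) - Complex.I • gardingEnd (hcpt := hcpt) (τ := τ) hτ (Matrix.single (0 : Fin 2) (0 : Fin 2) ((0, Pi.single w Complex.I) : mixedSpace K))) + (gardingEnd (hcpt := hcpt) (τ := τ) hτ (Matrix.single (0 : Fin 2) (0 : Fin 2) ((0, Pi.single w 1) : mixedSpace K)) + Complex.I • gardingEnd (hcpt := hcpt) (τ := τ) hτ (Matrix.single (0 : Fin 2) (0 : Fin 2) ((0, Pi.single w Complex.I) : mixedSpace K)))) y + ((gardingEnd (hcpt := hcpt) (τ := τ) hτ (Matrix.single (1 : Fin 2) (1 : Fin 2) ((0, Pi.single w 1) : mixedSpace K)) - Complex.I • gardingEnd (hcpt := hcpt) (τ := τ) hτ (Matrix.single (1 : Fin 2) (1 : Fin 2) ((0, Pi.single w Complex.I) : mixedSpace K))) + (gardingEnd (hcpt := hcpt) (τ := τ) hτ (Matrix.single (1 : Fin 2) (1 : Fin 2) ((0, Pi.single w 1) : mixedSpace K)) + Complex.I • gardingEnd (hcpt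 := hcpt) (τ := τ) hτ (Matrix.single (1 : Fin 2) (1 : Fin 2) ((0, Pi.single w Complex.I) : mixedSpace K)))) y = (2 * μ₁) • y ∧
    ((gardingEnd (hcpt := hcpt) (τ := τ) hτ (Matrix.single (0 : Fin 2) (1 : Fin 2) ((0, Pi.single w 1) : mixedSpace K)) - Complex.I • gardingEnd (hcpt := hcpt) (τ := τ) hτ (Matrix.single (0 : Fin 2) (1 : Fin 2) ((0, Pi.single w Complex.I) : mixedSpace K))) - (gardingEnd (hcpt := hcpt) (τ := τ) hτ (Matrix.single (1 : Fin 2) (0 : Fin 2) ((0, Pi.single w 1) : mixedSpace K)) + Complex.I • gardingEnd (hcpt := hcpt) (τ := τ) hτ (Matrix.single (1 : Fin 2) (0 : Fin 2) ((0, Pi.single w Complex.I) : mixedSpace K)))) (((gardingEnd (hcpt := hcpt) (τ := τ) hτ (Matrix.single (1 : Fin 2) (0 : Fin 2) ((0, Pi.single w 1) : mixedSpace K)) - Complex.I • gardingEnd (hcpt := hcpt) (τ := τ) hτ (Matrix.single (1 : Fin 2) (0 : Fin 2) ((0, Pi.single w Complex.I) : mixedSpace K))) - (gardingEnd (hcpt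 := hcpt) (τ := τ) hτ (Matrix.single (0 : Fin 2) (1 : Fin 2) ((0, Pi.single w 1) : mixedSpace K)) + Complex.I • gardingEnd (hcpt := hcpt) (τ := τ) hτ (Matrix.single (0 : Fin 2) (1 : Fin 2) ((0, Pi.single w Complex.I) : mixedSpace K)))) y) = (4 * (m : ℂ)) • y := by
  have h1 : gardingEnd (hcpt := hcpt) (τ := τ) hτ (Matrix.single 0 0 ((0, Pi.single w 1) : mixedSpace K)) y + gardingEnd (hcpt := hcpt) (τ := τ) hτ (Matrix.single 1 1 ((0, Pi.single w 1) : mixedSpace K)) y = μ₁ • y := by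
    have h := hZ1 y
    rwa [gardingEnd_add, LinearMap.add_apply] at h
  have h2 : gardingEnd (hcpt := hcpt) (τ := τ) hτ (Matrix.single 0 0 ((0, Pi.single w Complex.I) : mixedSpace K)) y + gardingEnd (hcpt := hcpt) (τ := τ) hτ (Matrix.single 1 1 ((0, Pi.single w Complex.I) : mixedSpace K)) y = μ₂ • y := by
    have h := hZ2 y
    rwa [gardingEnd_add, LinearMap.add_apply] at h
  have hZh : (gardingEnd (hcpt := hcpt) (τ := τ) hτ (Matrix.single (0 : Fin 2) (0 : Fin 2) ((0, Pi.single w 1) : mixedSpace K)) - Complex.I • gardingEnd (hcpt := hcpt) (τ := τ) hτ (Matrix.single (0 : Fin 2) (0 : Fin 2) ((0, Pi.single w Complex.I) : mixedSpace K))) y + (gardingEnd (hcpt := hcpt) (τ := τ) hτ (Matrix.single (1 : Fin 2) (1 : Fin 2) ((0, Pi.single w 1) : mixedSpace K)) - Complex.I • gardingEnd (hcpt := hcpt) (τ := τ) hτ (Matrix.single (1 : Fin 2) (1 : Fin 2) ((0, Pi.single w Complex.I) : mixedSpace K))) y = (μ₁ - Complex.I * μ₂) • y := by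
    simp only [LinearMap.sub_apply, LinearMap.smul_apply]
    rw [sub_smul, mul_smul, ← h1, ← h2, smul_add]
    abel
  have hZa : (gardingEnd (hcpt := hcpt) (τ := τ) hτ (Matrix.single (0 : Fin 2) (0 : Fin 2) ((0, Pi.single w 1) : mixedSpace K)) + Complex.I • gardingEnd (hcpt := hcpt) (τ := τ) hτ (Matrix.single (0 : Fin 2) (0 : Fin 2) ((0, Pi.single w Complex.I) : mixedSpace K))) y + (gardingEnd (hcpt := hcpt) (τ := τ) hτ (Matrix.single (1 : Fin 2) (1 : Fin 2) ((0, Pi.single w 1) : mixedSpace K)) + Complex.I • gardingEnd (hcpt := hcpt) (τ := τ) hτ (Matrix.single (1 : Fin 2) (1 : Fin 2) ((0, Pi.single w Complex.I) : mixedSpace K))) y = (μ₁ + Complex.I * μ₂) • y := by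
    simp only [LinearMap.add_apply, LinearMap.smul_apply]
    rw [add_smul, mul_smul, ← h1, ← h2, smul_add]
    abel
  -- `(K₀₀ - K₁₁) y = 2m y`
  have hdiff : ((gardingEnd (hcpt := hcpt) (τ := τ) hτ (Matrix.single (0 : Fin 2) (0 : Fin 2) ((0, Pi.single w 1) : mixedSpace K)) - Complex.I • gardingEnd (hcpt := hcpt) (τ := τ) hτ (Matrix.single (0 : Fin 2) (0 : Fin 2) ((0, Pi.single w Complex.I) : mixedSpace K))) - (gardingEnd (hcpt := hcpt) (τ := τ) hτ (Matrix.single (1 : Fin 2) (1 : Fin 2) ((0, Pi.single w 1) : mixedSpace K)) - Complex.I • gardingEnd (hcpt := hcpt) (τ := τ) hτ (Matrix.single (1 : Fin 2) (1 : Fin 2) ((0, Pi.single w Complex.I) : mixedSpace K)))) y - ((gardingEnd (hcpt := hcpt) (τ := τ) hτ (Matrix.single (0 : Fin 2) (0 : Fin 2) ((0, Pi.single w 1) : mixedSpace K)) + Complex.I • gardingEnd (hcpt := hcpt) (τ := τ) hτ (Matrix.single (0 : Fin 2) (0 : Fin 2) ((0, Pi.single w Complex.I) : mixedSpace K))) -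 (gardingEnd (hcpt := hcpt) (τ := τ) hτ (Matrix.single (1 : Fin 2) (1 : Fin 2) ((0, Pi.single w 1) : mixedSpace K)) + Complex.I • gardingEnd (hcpt := hcpt) (τ := τ) hτ (Matrix.single (1 : Fin 2) (1 : Fin 2) ((0, Pi.single w Complex.I) : mixedSpace K)))) y = (2 * (m : ℂ)) • y := by
    have h := LinearMap.congr_fun (holDiag_sub_antiDiag (hcpt := hcpt) (τ := τ) hτ w) y
    rw [LinearMap.sub_apply, LinearMap.smul_apply, hT, smul_smul] at h
    rw [h]
    congr 1
    rw [← mul_assoc, mul_assoc (-2 : ℂ), Complex.I_mul_I]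
    ring
  -- `E (F y) = 4m y`
  have hEF := raisingK_loweringK_pow_succ_apply hτ w (m : ℂ) y hE hT 0
  rw [zero_add, pow_one, pow_zero, Module.End.one_apply] at hEF
  set Hh0 : Module.End ℂ (archGardingSpace hcpt τ) := (gardingEnd (hcpt := hcpt) (τ := τ) hτ (Matrix.single (0 : Fin 2) (0 : Fin 2) ((0, Pi.single w 1) : mixedSpace K)) - Complex.I • gardingEnd (hcpt := hcpt) (τ := τ) hτ (Matrix.single (0 : Fin 2) (0 : Fin 2) ((0, Pi.single w Complex.I) : mixedSpace K)))
  set Hh1 : Module.End ℂ (archGardingSpace hcpt τ) := (gardingEnd (hcpt := hcpt) (τ := τ) hτ (Matrix.single (1 : Fin 2) (1 : Fin 2) ((0, Pi.single w 1) : mixedSpace K)) - Complex.I • gardingEnd (hcpt := hcpt) (τ := τ) hτ (Matrix.single (1 : Fin 2) (1 : Fin 2) ((0, Pi.single w Complex.I) : mixedSpace K)))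
  set Ha0 : Module.End ℂ (archGardingSpace hcpt τ) := (gardingEnd (hcpt := hcpt) (τ := τ) hτ (Matrix.single (0 : Fin 2) (0 : Fin 2) ((0, Pi.single w 1) : mixedSpace K)) + Complex.I • gardingEnd (hcpt := hcpt) (τ := τ) hτ (Matrix.single (0 : Fin 2) (0 : Fin 2) ((0, Pi.single w Complex.I) : mixedSpace K)))
  set Ha1 : Module.End ℂ (archGardingSpace hcpt τ) := (gardingEnd (hcpt := hcpt) (τ := τ) hτ (Matrix.single (1 : Fin 2) (1 : Fin 2) ((0, Pi.single w 1) : mixedSpace K)) + Complex.I • gardingEnd (hcpt := hcpt) (τ := τ) hτ (Matrix.single (1 : Fin 2) (1 : Fin 2) ((0, Pi.single w Complex.I) : mixedSpace K)))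
  have hsum : (Hh0 - Ha0) y + (Hh1 - Ha1) y = (-2 * Complex.I * μ₂) • y := by
    have e : (Hh0 - Ha0) y + (Hh1 - Ha1) y = (Hh0 y + Hh1 y) - (Ha0 y + Ha1 y) := by
      simp only [LinearMap.sub_apply]; abel
    rw [e, hZh, hZa, ← sub_smul]
    congr 1; ring
  have hdiff' : (Hh0 - Ha0) y - (Hh1 - Ha1) y = (2 * (m : ℂ)) • y := by
    rw [← hdiff]
    simp only [LinearMap.sub_apply]; abel
  refine ⟨?_, ?_, ?_, ?_⟩
  · have h2 : (2 : ℂ) • (Hh0 - Ha0) y = (-2 * Complex.I * μ₂ + 2 * (m : ℂ)) • y := by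
      rw [two_smul, add_smul, ← hsum, ← hdiff']; abel
    have h := congrArg (fun u => (2 : ℂ)⁻¹ • u) h2
    simp only [smul_smul, inv_mul_cancel₀ (two_ne_zero (α := ℂ)), one_smul] at h
    rw [h]; congr 1; ring
  · have h2 : (2 : ℂ) • (Hh1 - Ha1) y = (-2 * Complex.I * μ₂ - 2 * (m : ℂ)) • y := by
      rw [two_smul, sub_smul, ← hsum, ← hdiff']; abel
    have h := congrArg (fun u => (2 : ℂ)⁻¹ • u) h2
    simp only [smul_smul, inv_mul_cancel₀ (two_ne_zero (α := ℂ)), one_smul] at h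
    rw [h]; congr 1; ring
  · have e : (Hh0 + Ha0) y + (Hh1 + Ha1) y = (Hh0 y + Hh1 y) + (Ha0 y + Ha1 y) := by
      simp only [LinearMap.add_apply]; abel
    rw [e, hZh, hZa, ← add_smul]
    congr 1; ring
  · rw [hEF]
    congr 1
    push_cast
    ring

set_option maxHeartbeats 800000 in
/-- **The complex-place unitarity bound.** For a unitary `τ` with central scalars `μ₁, μ₂`, Casimir scalars
`λ^a = (μ₁+iμ₂)²/2 - 2ν² - 2`, `λ^h`, and a non-zero highest-weight Gårding vector `y` of torus weight `m`
(`E y = 0`, `τ(T) y = im y`): `(im ν)² ≤ ((m+2)/2)²`, with equality only if `P₀₁ y = (τ^h(E₀₁) + τ^a(E₁₀)) y = 0`.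
Proof: `Ω_𝔨 + Ω_𝔭 = 2C^h + 2C^a` and `C^h - C^a = Σ P_{ij} K_{ji}` evaluated on `y` against `y`, with
`P_{ij}* = -P_{ji}`, give `Σ ‖P_{ij} y‖² = (2m² + 4m + 2|μ₁|² + 8 re ν² + 8)‖y‖²`,
`(m+2) ⟪y, (P₀₀ - P₁₁) y⟫ = 8i re ν im ν ‖y‖²`, `⟪y, (P₀₀ + P₁₁) y⟫ = 2μ₁‖y‖²`, and Cauchy–Schwarz.
[cite: Knapp1986, Ch. XVI §1] [cite: JacquetLanglands1970, §6 Thm. 6.2] -/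
theorem sq_im_besselParamC_le (hτu : τ.IsUnitary) {μ₁ μ₂ lama lamh ν : ℂ} {m : ℕ}
    (hZ1 : ∀ v : archGardingSpace hcpt τ, gardingEnd (hcpt := hcpt) (τ := τ) hτ (Matrix.single 0 0 ((0, Pi.single w 1) : mixedSpace K) + Matrix.single 1 1 ((0, Pi.single w 1) : mixedSpace K)) v = μ₁ • v)
    (hZ2 : ∀ v : archGardingSpace hcpt τ, gardingEnd (hcpt := hcpt) (τ := τ) hτ (Matrix.single (0 : Fin 2) (0 : Fin 2) ((0, Pi.single w Complex.I) : mixedSpace K) + Matrix.single (1 : Fin 2) (1 : Fin 2) ((0, Pi.single w Complex.I) : mixedSpace K)) v = μ₂ • v)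
    (hCa : ∀ v : archGardingSpace hcpt τ, ∑ i : Fin 2, ∑ j : Fin 2, (gardingEnd (hcpt := hcpt) (τ := τ) hτ (Matrix.single (i : Fin 2) (j : Fin 2) ((0, Pi.single w 1) : mixedSpace K)) + Complex.I • gardingEnd (hcpt := hcpt) (τ := τ) hτ (Matrix.single (i : Fin 2) (j : Fin 2) ((0, Pi.single w Complex.I) : mixedSpace K))) ((gardingEnd (hcpt := hcpt) (τ := τ) hτ (Matrix.single (j : Fin 2) (i : Fin 2) ((0, Pi.single w 1) : mixedSpace K)) + Complex.I • gardingEnd (hcpt := hcpt) (τ := τ) hτ (Matrix.single (j : Fin 2) (i : Fin 2) ((0, Pi.single w Complex.I) : mixedSpace K))) v) = lama • v)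
    (hCh : ∀ v : archGardingSpace hcpt τ, ∑ i : Fin 2, ∑ j : Fin 2, (gardingEnd (hcpt := hcpt) (τ := τ) hτ (Matrix.single (i : Fin 2) (j : Fin 2) ((0, Pi.single w 1) : mixedSpace K)) - Complex.I • gardingEnd (hcpt := hcpt) (τ := τ) hτ (Matrix.single (i : Fin 2) (j : Fin 2) ((0, Pi.single w Complex.I) : mixedSpace K))) ((gardingEnd (hcpt := hcpt) (τ := τ) hτ (Matrix.single (j : Fin 2) (i : Fin 2) ((0, Pi.single w 1) : mixedSpace K)) - Complex.I • gardingEnd (hcpt := hcpt) (τ := τ) hτ (Matrix.single (j : Fin 2) (i : Fin 2) ((0, Pi.single w Complex.I) : mixedSpace K))) v) = lamh • v)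
    (hlama : lama = (μ₁ + Complex.I * μ₂) ^ 2 / 2 - 2 * ν ^ 2 - 2)
    {y : archGardingSpace hcpt τ} (hy0 : y ≠ 0)
    (hE : ((gardingEnd (hcpt := hcpt) (τ := τ) hτ (Matrix.single (0 : Fin 2) (1 : Fin 2) ((0, Pi.single w 1) : mixedSpace K)) - Complex.I • gardingEnd (hcpt := hcpt) (τ := τ) hτ (Matrix.single (0 : Fin 2) (1 : Fin 2) ((0, Pi.single w Complex.I) : mixedSpace K))) - (gardingEnd (hcpt := hcpt) (τ := τ) hτ (Matrix.single (1 : Fin 2) (0 : Fin 2) ((0, Pi.single w 1) : mixedSpace K)) + Complex.I • gardingEnd (hcpt := hcpt) (τ := τ) hτ (Matrix.single (1 : Fin 2) (0 : Fin 2) ((0, Pi.single w Complex.I) : mixedSpace K)))) y = 0) (hT : gardingEnd (hcpt := hcpt) (τ := τ) hτ (Matrix.single (0 : Fin 2) (0 : Fin 2) ((0, Pi.single w Complex.I) : mixedSpace K) - Matrix.single (1 : Fin 2) (1 : Fin 2) ((0, Pi.single w Complex.I) : mixedSpace K)) y = (Complex.I * m) • y) :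
    ν.im ^ 2 ≤ (((m : ℝ) + 2) / 2) ^ 2 ∧ (ν.im ^ 2 = (((m : ℝ) + 2) / 2) ^ 2 → ((gardingEnd (hcpt := hcpt) (τ := τ) hτ (Matrix.single (0 : Fin 2) (1 : Fin 2) ((0, Pi.single w 1) : mixedSpace K)) - Complex.I • gardingEnd (hcpt := hcpt) (τ := τ) hτ (Matrix.single (0 : Fin 2) (1 : Fin 2) ((0, Pi.single w Complex.I) : mixedSpace K))) + (gardingEnd (hcpt := hcpt) (τ := τ) hτ (Matrix.single (1 : Fin 2) (0 : Fin 2) ((0, Pi.single w 1) : mixedSpace K)) + Complex.I • gardingEnd (hcpt := hcpt) (τ := τ) hτ (Matrix.single (1 : Fin 2) (0 : Fin 2) ((0, Pi.single w Complex.I) : mixedSpace K)))) y = 0) := by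
  obtain ⟨hμ₁, hμ₂⟩ := re_complexCentral_eq_zero hτ w hτu hZ1 hZ2 hy0
  have hconj : conj lama = lamh := conj_placeCasimirAnti_eq hτ w hτu hy0 (hCa y) (hCh y)
  obtain ⟨hK00, hK11, hPsum, hEF⟩ := highest_kPart_apply hτ w hZ1 hZ2 hE hT
  -- the operator identities, applied to `y`
  have hΩ00 := LinearMap.congr_fun (kPart_mul_add_pPart_mul (hcpt := hcpt) (τ := τ) hτ w 0 0) y
  have hΩ01 := LinearMap.congr_fun (kPart_mul_add_pPart_mul (hcpt := hcpt) (τ := τ) hτ w 0 1) y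
  have hΩ10 := LinearMap.congr_fun (kPart_mul_add_pPart_mul (hcpt := hcpt) (τ := τ) hτ w 1 0) y
  have hΩ11 := LinearMap.congr_fun (kPart_mul_add_pPart_mul (hcpt := hcpt) (τ := τ) hτ w 1 1) y
  have hCK := sum_pPart_kPart_apply hτ w y (hCa y) (hCh y)
  have hKP := LinearMap.congr_fun (kPart01_mul_pPart10 (hcpt := hcpt) (τ := τ) hτ w) y
  -- the adjoint relations needed
  have hPP00 := inner_pPart_pPart_self hτ w hτu 0 0 y
  have hPP01 := inner_pPart_pPart_self hτ w hτu 0 1 y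
  have hPP10 := inner_pPart_pPart_self hτ w hτu 1 0 y
  have hPP11 := inner_pPart_pPart_self hτ w hτu 1 1 y
  have hPadj := inner_pPart_right hτ w hτu 0 1 y (((gardingEnd (hcpt := hcpt) (τ := τ) hτ (Matrix.single (1 : Fin 2) (0 : Fin 2) ((0, Pi.single w 1) : mixedSpace K)) - Complex.I • gardingEnd (hcpt := hcpt) (τ := τ) hτ (Matrix.single (1 : Fin 2) (0 : Fin 2) ((0, Pi.single w Complex.I) : mixedSpace K))) - (gardingEnd (hcpt := hcpt) (τ := τ) hτ (Matrix.single (0 : Fin 2) (1 : Fin 2) ((0, Pi.single w 1) : mixedSpace K)) + Complex.I • gardingEnd (hcpt := hcpt) (τ := τ) hτ (Matrix.single (0 : Fin 2) (1 : Fin 2) ((0, Pi.single w Complex.I) : mixedSpace K)))) y)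
  have hKadj := inner_kPart_right hτ w hτu 0 1 y (((gardingEnd (hcpt := hcpt) (τ := τ) hτ (Matrix.single (1 : Fin 2) (0 : Fin 2) ((0, Pi.single w 1) : mixedSpace K)) - Complex.I • gardingEnd (hcpt := hcpt) (τ := τ) hτ (Matrix.single (1 : Fin 2) (0 : Fin 2) ((0, Pi.single w Complex.I) : mixedSpace K))) + (gardingEnd (hcpt := hcpt) (τ := τ) hτ (Matrix.single (0 : Fin 2) (1 : Fin 2) ((0, Pi.single w 1) : mixedSpace K)) + Complex.I • gardingEnd (hcpt := hcpt) (τ := τ) hτ (Matrix.single (0 : Fin 2) (1 : Fin 2) ((0, Pi.single w Complex.I) : mixedSpace K)))) y)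
  have hAre : (⟪y, ((gardingEnd (hcpt := hcpt) (τ := τ) hτ (Matrix.single (0 : Fin 2) (0 : Fin 2) ((0, Pi.single w 1) : mixedSpace K)) - Complex.I • gardingEnd (hcpt := hcpt) (τ := τ) hτ (Matrix.single (0 : Fin 2) (0 : Fin 2) ((0, Pi.single w Complex.I) : mixedSpace K))) + (gardingEnd (hcpt := hcpt) (τ := τ) hτ (Matrix.single (0 : Fin 2) (0 : Fin 2) ((0, Pi.single w 1) : mixedSpace K)) + Complex.I • gardingEnd (hcpt := hcpt) (τ := τ) hτ (Matrix.single (0 : Fin 2) (0 : Fin 2) ((0, Pi.single w Complex.I) : mixedSpace K)))) y⟫_ℂ).re = 0 := by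
    have h := congrArg Complex.re (inner_pPart_right hτ w hτu 0 0 y y)
    have h2 := inner_re_symm (𝕜 := ℂ) (((gardingEnd (hcpt := hcpt) (τ := τ) hτ (Matrix.single (0 : Fin 2) (0 : Fin 2) ((0, Pi.single w 1) : mixedSpace K)) - Complex.I • gardingEnd (hcpt := hcpt) (τ := τ) hτ (Matrix.single (0 : Fin 2) (0 : Fin 2) ((0, Pi.single w Complex.I) : mixedSpace K))) + (gardingEnd (hcpt := hcpt) (τ := τ) hτ (Matrix.single (0 : Fin 2) (0 : Fin 2) ((0, Pi.single w 1) : mixedSpace K)) + Complex.I • gardingEnd (hcpt := hcpt) (τ := τ) hτ (Matrix.single (0 : Fin 2) (0 : Fin 2) ((0, Pi.single w Complex.I) : mixedSpace K)))) y) y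
    simp only [RCLike.re_to_complex] at h2
    rw [Complex.neg_re, h2] at h
    linarith
  have hBre : (⟪y, ((gardingEnd (hcpt := hcpt) (τ := τ) hτ (Matrix.single (1 : Fin 2) (1 : Fin 2) ((0, Pi.single w 1) : mixedSpace K)) - Complex.I • gardingEnd (hcpt := hcpt) (τ := τ) hτ (Matrix.single (1 : Fin 2) (1 : Fin 2) ((0, Pi.single w Complex.I) : mixedSpace K))) + (gardingEnd (hcpt := hcpt) (τ := τ) hτ (Matrix.single (1 : Fin 2) (1 : Fin 2) ((0, Pi.single w 1) : mixedSpace K)) + Complex.I • gardingEnd (hcpt := hcpt) (τ := τ) hτ (Matrix.single (1 : Fin 2) (1 : Fin 2) ((0, Pi.single w Complex.I) : mixedSpace K)))) y⟫_ℂ).re = 0 := by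
    have h := congrArg Complex.re (inner_pPart_right hτ w hτu 1 1 y y)
    have h2 := inner_re_symm (𝕜 := ℂ) (((gardingEnd (hcpt := hcpt) (τ := τ) hτ (Matrix.single (1 : Fin 2) (1 : Fin 2) ((0, Pi.single w 1) : mixedSpace K)) - Complex.I • gardingEnd (hcpt := hcpt) (τ := τ) hτ (Matrix.single (1 : Fin 2) (1 : Fin 2) ((0, Pi.single w Complex.I) : mixedSpace K))) + (gardingEnd (hcpt := hcpt) (τ := τ) hτ (Matrix.single (1 : Fin 2) (1 : Fin 2) ((0, Pi.single w 1) : mixedSpace K)) + Complex.I • gardingEnd (hcpt := hcpt) (τ := τ) hτ (Matrix.single (1 : Fin 2) (1 : Fin 2) ((0, Pi.single w Complex.I) : mixedSpace K)))) y) y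
    simp only [RCLike.re_to_complex] at h2
    rw [Complex.neg_re, h2] at h
    linarith
  have hCa' := hCa y
  have hCh' := hCh y
  simp only [Fin.sum_univ_two] at hCa' hCh'
  -- atoms
  set Ph : Module.End ℂ (archGardingSpace hcpt τ) := (gardingEnd (hcpt := hcpt) (τ := τ) hτ (Matrix.single (0 : Fin 2) (1 : Fin 2) ((0, Pi.single w 1) : mixedSpace K)) - Complex.I • gardingEnd (hcpt := hcpt) (τ := τ) hτ (Matrix.single (0 : Fin 2) (1 : Fin 2) ((0, Pi.single w Complex.I) : mixedSpace K))) with hPh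
  set Mh : Module.End ℂ (archGardingSpace hcpt τ) := (gardingEnd (hcpt := hcpt) (τ := τ) hτ (Matrix.single (1 : Fin 2) (0 : Fin 2) ((0, Pi.single w 1) : mixedSpace K)) - Complex.I • gardingEnd (hcpt := hcpt) (τ := τ) hτ (Matrix.single (1 : Fin 2) (0 : Fin 2) ((0, Pi.single w Complex.I) : mixedSpace K))) with hMh
  set Pa : Module.End ℂ (archGardingSpace hcpt τ) := (gardingEnd (hcpt := hcpt) (τ := τ) hτ (Matrix.single (0 : Fin 2) (1 : Fin 2) ((0, Pi.single w 1) : mixedSpace K)) + Complex.I • gardingEnd (hcpt := hcpt) (τ := τ) hτ (Matrix.single (0 : Fin 2) (1 : Fin 2) ((0, Pi.single w Complex.I) : mixedSpace K))) with hPa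
  set Ma : Module.End ℂ (archGardingSpace hcpt τ) := (gardingEnd (hcpt := hcpt) (τ := τ) hτ (Matrix.single (1 : Fin 2) (0 : Fin 2) ((0, Pi.single w 1) : mixedSpace K)) + Complex.I • gardingEnd (hcpt := hcpt) (τ := τ) hτ (Matrix.single (1 : Fin 2) (0 : Fin 2) ((0, Pi.single w Complex.I) : mixedSpace K))) with hMa
  set Hh0 : Module.End ℂ (archGardingSpace hcpt τ) := (gardingEnd (hcpt := hcpt) (τ := τ) hτ (Matrix.single (0 : Fin 2) (0 : Fin 2) ((0, Pi.single w 1) : mixedSpace K)) - Complex.I • gardingEnd (hcpt := hcpt) (τ := τ) hτ (Matrix.single (0 : Fin 2) (0 : Fin 2) ((0, Pi.single w Complex.I) : mixedSpace K))) with hHh0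
  set Hh1 : Module.End ℂ (archGardingSpace hcpt τ) := (gardingEnd (hcpt := hcpt) (τ := τ) hτ (Matrix.single (1 : Fin 2) (1 : Fin 2) ((0, Pi.single w 1) : mixedSpace K)) - Complex.I • gardingEnd (hcpt := hcpt) (τ := τ) hτ (Matrix.single (1 : Fin 2) (1 : Fin 2) ((0, Pi.single w Complex.I) : mixedSpace K))) with hHh1
  set Ha0 : Module.End ℂ (archGardingSpace hcpt τ) := (gardingEnd (hcpt := hcpt) (τ := τ) hτ (Matrix.single (0 : Fin 2) (0 : Fin 2) ((0, Pi.single w 1) : mixedSpace K)) + Complex.I • gardingEnd (hcpt := hcpt) (τ := τ) hτ (Matrix.single (0 : Fin 2) (0 : Fin 2) ((0, Pi.single w Complex.I) : mixedSpace K))) with hHa0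
  set Ha1 : Module.End ℂ (archGardingSpace hcpt τ) := (gardingEnd (hcpt := hcpt) (τ := τ) hτ (Matrix.single (1 : Fin 2) (1 : Fin 2) ((0, Pi.single w 1) : mixedSpace K)) + Complex.I • gardingEnd (hcpt := hcpt) (τ := τ) hτ (Matrix.single (1 : Fin 2) (1 : Fin 2) ((0, Pi.single w Complex.I) : mixedSpace K))) with hHa1
  -- scalar quantities
  set N : ℝ := ‖y‖ ^ 2 with hN
  have hNpos : 0 < N := by rw [hN]; positivity
  have hyy : ⟪y, y⟫_ℂ = (N : ℂ) := by rw [hN, inner_self_eq_norm_sq_to_K]; norm_cast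
  set A : ℂ := ⟪y, (Hh0 + Ha0) y⟫_ℂ with hA
  set B : ℂ := ⟪y, (Hh1 + Ha1) y⟫_ℂ with hB
  set n00 : ℝ := ‖(Hh0 + Ha0) y‖ ^ 2 with hn00
  set n11 : ℝ := ‖(Hh1 + Ha1) y‖ ^ 2 with hn11
  set n01 : ℝ := ‖(Ph + Ma) y‖ ^ 2 with hn01
  set n10 : ℝ := ‖(Mh + Pa) y‖ ^ 2 with hn10
  -- (1) `Ω_𝔨 + Ω_𝔭 = 2C^h + 2C^a` against `y`
  have eCh : ⟪y, Hh0 (Hh0 y)⟫_ℂ + ⟪y, Ph (Mh y)⟫_ℂ + (⟪y, Mh (Ph y)⟫_ℂ + ⟪y, Hh1 (Hh1 y)⟫_ℂ) = lamh * N := by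
    have h := congrArg (fun z => ⟪y, z⟫_ℂ) hCh'
    simp only [inner_add_right, inner_smul_right] at h
    rwa [hyy] at h
  have eCa : ⟪y, Ha0 (Ha0 y)⟫_ℂ + ⟪y, Pa (Ma y)⟫_ℂ + (⟪y, Ma (Pa y)⟫_ℂ + ⟪y, Ha1 (Ha1 y)⟫_ℂ) = lama * N := by
    have h := congrArg (fun z => ⟪y, z⟫_ℂ) hCa'
    simp only [inner_add_right, inner_smul_right] at h
    rwa [hyy] at h
  have hKK00 : (Hh0 - Ha0) ((Hh0 - Ha0) y) = (((m : ℂ) - Complex.I * μ₂) ^ 2) • y := by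
    rw [hK00, map_smul, hK00, smul_smul, sq]
  have hKK11 : (Hh1 - Ha1) ((Hh1 - Ha1) y) = ((-(m : ℂ) - Complex.I * μ₂) ^ 2) • y := by
    rw [hK11, map_smul, hK11, smul_smul, sq]
  have hKK10 : (Mh - Pa) ((Ph - Ma) y) = 0 := by rw [hE, map_zero]
  have e00 : ((m : ℂ) - Complex.I * μ₂) ^ 2 * N + (-(n00 : ℂ)) = 2 * ⟪y, Hh0 (Hh0 y)⟫_ℂ + 2 * ⟪y, Ha0 (Ha0 y)⟫_ℂ := by
    have h := congrArg (inner ℂ y) hΩ00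
    rw [LinearMap.add_apply, Module.End.mul_apply, Module.End.mul_apply, inner_add_right, hKK00, hPP00, inner_smul_right, hyy,
      LinearMap.add_apply, LinearMap.smul_apply, LinearMap.smul_apply, Module.End.mul_apply, Module.End.mul_apply, inner_add_right,
      inner_smul_right, inner_smul_right] at h
    rw [← h]
  have e01 : (4 * (m : ℂ)) * N + (-(n10 : ℂ)) = 2 * ⟪y, Ph (Mh y)⟫_ℂ + 2 * ⟪y, Ma (Pa y)⟫_ℂ := by
    have h := congrArg (inner ℂ y) hΩ01
    rw [LinearMap.add_apply, Module.End.mul_apply, Module.End.mul_apply, inner_add_right, hEF, hPP01, inner_smul_right, hyy,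
      LinearMap.add_apply, LinearMap.smul_apply, LinearMap.smul_apply, Module.End.mul_apply, Module.End.mul_apply, inner_add_right,
      inner_smul_right, inner_smul_right] at h
    rw [← h]
  have e10 : (0 : ℂ) + (-(n01 : ℂ)) = 2 * ⟪y, Mh (Ph y)⟫_ℂ + 2 * ⟪y, Pa (Ma y)⟫_ℂ := by
    have h := congrArg (inner ℂ y) hΩ10
    rw [LinearMap.add_apply, Module.End.mul_apply, Module.End.mul_apply, inner_add_right, hKK10, hPP10, inner_zero_right,
      LinearMap.add_apply, LinearMap.smul_apply, LinearMap.smul_apply, Module.End.mul_apply, Module.End.mul_apply, inner_add_right,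
      inner_smul_right, inner_smul_right] at h
    rw [← h]
  have e11 : (-(m : ℂ) - Complex.I * μ₂) ^ 2 * N + (-(n11 : ℂ)) = 2 * ⟪y, Hh1 (Hh1 y)⟫_ℂ + 2 * ⟪y, Ha1 (Ha1 y)⟫_ℂ := by
    have h := congrArg (inner ℂ y) hΩ11
    rw [LinearMap.add_apply, Module.End.mul_apply, Module.End.mul_apply, inner_add_right, hKK11, hPP11, inner_smul_right, hyy,
      LinearMap.add_apply, LinearMap.smul_apply, LinearMap.smul_apply, Module.End.mul_apply, Module.End.mul_apply, inner_add_right,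
      inner_smul_right, inner_smul_right] at h
    rw [← h]
  have eΩ : ((m : ℂ) - Complex.I * μ₂) ^ 2 * N + (4 * (m : ℂ)) * N + (-(m : ℂ) - Complex.I * μ₂) ^ 2 * N -
      ((n00 : ℂ) + n10 + n01 + n11) = 2 * (lamh * N) + 2 * (lama * N) := by
    linear_combination e00 + e01 + e10 + e11 + 2 * eCh + 2 * eCa
  -- (2) `conj A = -A`, `conj B = -B`
  have hcA : conj A = -A := by
    apply Complex.ext
    · rw [Complex.conj_re, Complex.neg_re, hAre, neg_zero]
    · rw [Complex.conj_im, Complex.neg_im]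
  have hcB : conj B = -B := by
    apply Complex.ext
    · rw [Complex.conj_re, Complex.neg_re, hBre, neg_zero]
    · rw [Complex.conj_im, Complex.neg_im]
  -- (3) `C^h - C^a = Σ P K` against `y`
  have hKPy : ⟪y, (Ph - Ma) ((Mh + Pa) y)⟫_ℂ = 2 * (A - B) := by
    rw [← Module.End.mul_apply, hKP, LinearMap.add_apply, Module.End.mul_apply, hE, map_zero, zero_add, LinearMap.smul_apply,
      inner_smul_right, LinearMap.sub_apply, inner_sub_right]
  have hcross : ⟪y, (Ph + Ma) ((Mh - Pa) y)⟫_ℂ = 2 * (A - B) := by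
    rw [hPadj, ← inner_conj_symm, ← hKadj, hKPy, map_mul, map_sub, hcA, hcB, Complex.conj_ofNat]
    ring
  have e4 : ((m : ℂ) - Complex.I * μ₂) * A + 2 * (A - B) + (-(m : ℂ) - Complex.I * μ₂) * B = (lamh - lama) * N := by
    have h := hCK
    rw [hK00, hK11, hE, map_zero, map_smul, map_smul] at h
    have h' := congrArg (fun z => ⟪y, z⟫_ℂ) h
    simp only [inner_add_right, inner_smul_right, inner_zero_right] at h'
    rw [hcross, hyy] at h'
    linear_combination h'
  -- (4) `A + B = 2 μ₁ N`
  have e5 : A + B = 2 * μ₁ * N := by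
    have h := congrArg (fun z => ⟪y, z⟫_ℂ) hPsum
    simp only [inner_add_right, inner_smul_right] at h
    rw [hyy] at h
    exact h
  -- (5) Cauchy–Schwarz
  have csA : ‖A‖ ^ 2 ≤ N * n00 := by
    have h : ‖A‖ ≤ ‖y‖ * ‖(Hh0 + Ha0) y‖ := norm_inner_le_norm y _
    have h2 := pow_le_pow_left₀ (norm_nonneg _) h 2
    rw [mul_pow] at h2
    exact h2
  have csB : ‖B‖ ^ 2 ≤ N * n11 := by
    have h : ‖B‖ ≤ ‖y‖ * ‖(Hh1 + Ha1) y‖ := norm_inner_le_norm y _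
    have h2 := pow_le_pow_left₀ (norm_nonneg _) h 2
    rw [mul_pow] at h2
    exact h2
  -- (6) real coordinates
  have hn01 : n01 = 0 → (Ph + Ma) y = 0 := fun h0 => by
    have h1 : ‖(Ph + Ma) y‖ ^ 2 = 0 := h0
    rwa [sq_eq_zero_iff, norm_eq_zero] at h1
  have hn01nn : 0 ≤ n01 := by positivity
  have hn10nn : 0 ≤ n10 := by positivity
  clear_value Ph Mh Pa Ma Hh0 Hh1 Ha0 Ha1 N A B n00 n11 n01 n10
  have hAre' : A.re = 0 := by
    have h := congrArg Complex.re hcA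
    rw [Complex.conj_re, Complex.neg_re] at h
    linarith
  have hBre' : B.re = 0 := by
    have h := congrArg Complex.re hcB
    rw [Complex.conj_re, Complex.neg_re] at h
    linarith
  obtain ⟨α, rfl⟩ : ∃ α : ℝ, μ₁ = α * Complex.I := ⟨μ₁.im, Complex.ext (by simp [hμ₁]) (by simp)⟩
  obtain ⟨β, rfl⟩ : ∃ β : ℝ, μ₂ = β * Complex.I := ⟨μ₂.im, Complex.ext (by simp [hμ₂]) (by simp)⟩
  obtain ⟨a, rfl⟩ : ∃ a : ℝ, A = a * Complex.I := ⟨A.im, Complex.ext (by simp [hAre']) (by simp)⟩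
  obtain ⟨b, rfl⟩ : ∃ b : ℝ, B = b * Complex.I := ⟨B.im, Complex.ext (by simp [hBre']) (by simp)⟩
  obtain ⟨r, h, rfl⟩ : ∃ r h : ℝ, ν = r + h * Complex.I := ⟨ν.re, ν.im, (Complex.re_add_im ν).symm⟩
  subst hlama
  subst hconj
  have hIm : (((r : ℂ) + h * Complex.I).im) = h := by simp
  rw [hIm]
  -- the real equations
  have R1 := congrArg Complex.re eΩ
  have R4 := congrArg Complex.im e4
  have R5 := congrArg Complex.im e5
  simp only [sq, Complex.add_re, Complex.sub_re, Complex.mul_re, Complex.neg_re, Complex.add_im, Complex.sub_im,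
    Complex.mul_im, Complex.neg_im, Complex.ofReal_re, Complex.ofReal_im, Complex.I_re, Complex.I_im,
    Complex.natCast_re, Complex.natCast_im, Complex.re_ofNat, Complex.im_ofNat, Complex.conj_re, Complex.conj_im,
    Complex.div_ofNat_re, Complex.div_ofNat_im, mul_zero, zero_mul, sub_zero, add_zero, mul_one, one_mul,
    zero_add, zero_sub, neg_zero] at R1 R4 R5
  have csA' : a ^ 2 ≤ N * n00 := by
    rw [Complex.norm_mul, Complex.norm_I, mul_one, Complex.norm_real, Real.norm_eq_abs, sq_abs] at csA
    exact csA
  have csB' : b ^ 2 ≤ N * n11 := by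
    rw [Complex.norm_mul, Complex.norm_I, mul_one, Complex.norm_real, Real.norm_eq_abs, sq_abs] at csB
    exact csB
  -- (7) the inequality `4 N² ((m+2)² + 4r²) ((m+2)² - 4h²) ≥ 2 (m+2)² N (n01 + n10) + 8 m (m+2)² N²`
  clear eΩ e4 e5 csA csB hcA hcB e00 e01 e10 e11 eCh eCa hKK00 hKK11 hKK10 hKPy hcross hΩ00 hΩ01 hΩ10 hΩ11 hCK hKP
    hPP00 hPP01 hPP10 hPP11 hPadj hKadj hCa' hCh' hK00 hK11 hPsum hEF hyy hAre hBre hAre' hBre' hIm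
  have hm0 : (0 : ℝ) ≤ m := Nat.cast_nonneg m
  set M : ℝ := ((m : ℝ) + 2) ^ 2 with hM
  have hMpos : 0 < M := by rw [hM]; positivity
  have R45 : ((m : ℝ) + 2) * (a - b) = 8 * r * h * N := by linear_combination R4 - β * R5
  have T1 : 2 * a ^ 2 + 2 * b ^ 2 ≤ 2 * N * (n00 + n11) := by linarith [csA', csB']
  have T2 : M * (2 * a ^ 2 + 2 * b ^ 2) = 4 * α ^ 2 * M * N ^ 2 + 64 * r ^ 2 * h ^ 2 * N ^ 2 := by
    rw [hM]
    linear_combination (((m : ℝ) + 2) ^ 2 * (a + b + 2 * α * N)) * R5 + (((m : ℝ) + 2) * (a - b) + 8 * r * h * N) * R45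
  have T3 : n00 + n11 = (2 * (m : ℝ) ^ 2 + 4 * m + 2 * α ^ 2 + 8 * r ^ 2 - 8 * h ^ 2 + 8) * N - n01 - n10 := by
    linear_combination (-1 : ℝ) * R1
  have I1 : M * (2 * a ^ 2 + 2 * b ^ 2) ≤ M * (2 * N * (n00 + n11)) := mul_le_mul_of_nonneg_left T1 hMpos.le
  rw [T2, T3] at I1
  have I2 : 2 * M * N * (n01 + n10) + 8 * (m : ℝ) * M * N ^ 2 ≤ 4 * N ^ 2 * ((M + 4 * r ^ 2) * (M - 4 * h ^ 2)) := by
    rw [hM] at I1 ⊢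
    linarith [I1]
  have p1 : 0 ≤ 2 * M * N * (n01 + n10) := mul_nonneg (mul_nonneg (mul_nonneg zero_le_two hMpos.le) hNpos.le) (add_nonneg hn01nn hn10nn)
  have p2 : 0 ≤ 8 * (m : ℝ) * M * N ^ 2 := mul_nonneg (mul_nonneg (mul_nonneg (by norm_num) hm0) hMpos.le) (sq_nonneg N)
  have I3 : 4 * N ^ 2 * 0 ≤ 4 * N ^ 2 * ((M + 4 * r ^ 2) * (M - 4 * h ^ 2)) := by
    rw [mul_zero]; linarith [I2, p1, p2]
  have I4 : (M + 4 * r ^ 2) * 0 ≤ (M + 4 * r ^ 2) * (M - 4 * h ^ 2) := by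
    rw [mul_zero]
    exact le_of_mul_le_mul_left I3 (by positivity)
  have I5 : 0 ≤ M - 4 * h ^ 2 := le_of_mul_le_mul_left I4 (by positivity)
  refine ⟨?_, fun heq => ?_⟩
  · have e : (((m : ℝ) + 2) / 2) ^ 2 = M / 4 := by rw [hM]; ring
    rw [e]
    linarith [I5]
  · have hM4 : M - 4 * h ^ 2 = 0 := by rw [hM, heq]; ring
    rw [hM4, mul_zero, mul_zero] at I2
    apply hn01
    have p3 : 0 ≤ 2 * M * N * n10 := mul_nonneg (mul_nonneg (mul_nonneg zero_le_two hMpos.le) hNpos.le) hn10nn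
    have h6 : 2 * M * N * n01 ≤ 2 * M * N * 0 := by
      rw [mul_zero]; nlinarith [I2, p2, p3]
    have h7 : n01 ≤ 0 := le_of_mul_le_mul_left h6 (by positivity)
    exact le_antisymm h7 hn01nn

/-- **`|im ν| ≤ (m+2)/2`** for the Bessel parameter of the antiholomorphic Casimir scalar
(`λ^a = (μ₁+iμ₂)²/2 - 2ν² - 2`) at a non-zero highest-weight vector of torus weight `m` of a unitary
representation. [cite: Knapp1986, Ch. XVI §1] -/
theorem abs_im_besselParamC_le (hτu : τ.IsUnitary) {μ₁ μ₂ lama lamh ν : ℂ} {m : ℕ}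
    (hZ1 : ∀ v : archGardingSpace hcpt τ, gardingEnd (hcpt := hcpt) (τ := τ) hτ (Matrix.single 0 0 ((0, Pi.single w 1) : mixedSpace K) + Matrix.single 1 1 ((0, Pi.single w 1) : mixedSpace K)) v = μ₁ • v)
    (hZ2 : ∀ v : archGardingSpace hcpt τ, gardingEnd (hcpt := hcpt) (τ := τ) hτ (Matrix.single (0 : Fin 2) (0 : Fin 2) ((0, Pi.single w Complex.I) : mixedSpace K) + Matrix.single (1 : Fin 2) (1 : Fin 2) ((0, Pi.single w Complex.I) : mixedSpace K)) v = μ₂ • v)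
    (hCa : ∀ v : archGardingSpace hcpt τ, ∑ i : Fin 2, ∑ j : Fin 2, (gardingEnd (hcpt := hcpt) (τ := τ) hτ (Matrix.single (i : Fin 2) (j : Fin 2) ((0, Pi.single w 1) : mixedSpace K)) + Complex.I • gardingEnd (hcpt := hcpt) (τ := τ) hτ (Matrix.single (i : Fin 2) (j : Fin 2) ((0, Pi.single w Complex.I) : mixedSpace K))) ((gardingEnd (hcpt := hcpt) (τ := τ) hτ (Matrix.single (j : Fin 2) (i : Fin 2) ((0, Pi.single w 1) : mixedSpace K)) + Complex.I • gardingEnd (hcpt := hcpt) (τ := τ) hτ (Matrix.single (j : Fin 2) (i : Fin 2) ((0, Pi.single w Complex.I) : mixedSpace K))) v) = lama • v)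
    (hCh : ∀ v : archGardingSpace hcpt τ, ∑ i : Fin 2, ∑ j : Fin 2, (gardingEnd (hcpt := hcpt) (τ := τ) hτ (Matrix.single (i : Fin 2) (j : Fin 2) ((0, Pi.single w 1) : mixedSpace K)) - Complex.I • gardingEnd (hcpt := hcpt) (τ := τ) hτ (Matrix.single (i : Fin 2) (j : Fin 2) ((0, Pi.single w Complex.I) : mixedSpace K))) ((gardingEnd (hcpt := hcpt) (τ := τ) hτ (Matrix.single (j : Fin 2) (i : Fin 2) ((0, Pi.single w 1) : mixedSpace K)) - Complex.I • gardingEnd (hcpt := hcpt) (τ := τ) hτ (Matrix.single (j : Fin 2) (i : Fin 2) ((0, Pi.single w Complex.I) : mixedSpace K))) v) = lamh • v)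
    (hlama : lama = (μ₁ + Complex.I * μ₂) ^ 2 / 2 - 2 * ν ^ 2 - 2)
    {y : archGardingSpace hcpt τ} (hy0 : y ≠ 0)
    (hE : ((gardingEnd (hcpt := hcpt) (τ := τ) hτ (Matrix.single (0 : Fin 2) (1 : Fin 2) ((0, Pi.single w 1) : mixedSpace K)) - Complex.I • gardingEnd (hcpt := hcpt) (τ := τ) hτ (Matrix.single (0 : Fin 2) (1 : Fin 2) ((0, Pi.single w Complex.I) : mixedSpace K))) - (gardingEnd (hcpt := hcpt) (τ := τ) hτ (Matrix.single (1 : Fin 2) (0 : Fin 2) ((0, Pi.single w 1) : mixedSpace K)) + Complex.I • gardingEnd (hcpt := hcpt) (τ := τ) hτ (Matrix.single (1 : Fin 2) (0 : Fin 2) ((0, Pi.single w Complex.I) : mixedSpace K)))) y = 0) (hT : gardingEnd (hcpt := hcpt) (τ := τ) hτ (Matrix.single (0 : Fin 2) (0 : Fin 2) ((0, Pi.single w Complex.I) : mixedSpace K) - Matrix.single (1 : Fin 2) (1 : Fin 2) ((0, Pi.single w Complex.I) : mixedSpace K)) y = (Complex.I * m) • y) :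
    |ν.im| ≤ ((m : ℝ) + 2) / 2 := by
  have h := (sq_im_besselParamC_le hτ w hτu hZ1 hZ2 hCa hCh hlama hy0 hE hT).1
  have h0 : (0 : ℝ) ≤ ((m : ℝ) + 2) / 2 := by positivity
  exact abs_le_of_sq_le_sq' h h0 |>.elim (fun h1 h2 => abs_le.mpr ⟨h1, h2⟩)

/-- **`|im ν| < (m+2)/2` as soon as `τ^h(E₀₁) y ≠ 0`** (the equality case forces
`(τ^h(E₀₁) + τ^a(E₁₀)) y = 0`, i.e. `2 τ^h(E₀₁) y = 0` for a highest-weight vector). [cite: Knapp1986, Ch. XVI §1] -/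
theorem abs_im_besselParamC_lt_of_ne (hτu : τ.IsUnitary) {μ₁ μ₂ lama lamh ν : ℂ} {m : ℕ}
    (hZ1 : ∀ v : archGardingSpace hcpt τ, gardingEnd (hcpt := hcpt) (τ := τ) hτ (Matrix.single 0 0 ((0, Pi.single w 1) : mixedSpace K) + Matrix.single 1 1 ((0, Pi.single w 1) : mixedSpace K)) v = μ₁ • v)
    (hZ2 : ∀ v : archGardingSpace hcpt τ, gardingEnd (hcpt := hcpt) (τ := τ) hτ (Matrix.single (0 : Fin 2) (0 : Fin 2) ((0, Pi.single w Complex.I) : mixedSpace K) + Matrix.single (1 : Fin 2) (1 : Fin 2) ((0, Pi.single w Complex.I) : mixedSpace K)) v = μ₂ • v)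
    (hCa : ∀ v : archGardingSpace hcpt τ, ∑ i : Fin 2, ∑ j : Fin 2, (gardingEnd (hcpt := hcpt) (τ := τ) hτ (Matrix.single (i : Fin 2) (j : Fin 2) ((0, Pi.single w 1) : mixedSpace K)) + Complex.I • gardingEnd (hcpt := hcpt) (τ := τ) hτ (Matrix.single (i : Fin 2) (j : Fin 2) ((0, Pi.single w Complex.I) : mixedSpace K))) ((gardingEnd (hcpt := hcpt) (τ := τ) hτ (Matrix.single (j : Fin 2) (i : Fin 2) ((0, Pi.single w 1) : mixedSpace K)) + Complex.I • gardingEnd (hcpt := hcpt) (τ := τ) hτ (Matrix.single (j : Fin 2) (i : Fin 2) ((0, Pi.single w Complex.I) : mixedSpace K))) v) = lama • v)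
    (hCh : ∀ v : archGardingSpace hcpt τ, ∑ i : Fin 2, ∑ j : Fin 2, (gardingEnd (hcpt := hcpt) (τ := τ) hτ (Matrix.single (i : Fin 2) (j : Fin 2) ((0, Pi.single w 1) : mixedSpace K)) - Complex.I • gardingEnd (hcpt := hcpt) (τ := τ) hτ (Matrix.single (i : Fin 2) (j : Fin 2) ((0, Pi.single w Complex.I) : mixedSpace K))) ((gardingEnd (hcpt := hcpt) (τ := τ) hτ (Matrix.single (j : Fin 2) (i : Fin 2) ((0, Pi.single w 1) : mixedSpace K)) - Complex.I • gardingEnd (hcpt := hcpt) (τ := τ) hτ (Matrix.single (j : Fin 2) (i : Fin 2) ((0, Pi.single w Complex.I) : mixedSpace K))) v) = lamh • v)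
    (hlama : lama = (μ₁ + Complex.I * μ₂) ^ 2 / 2 - 2 * ν ^ 2 - 2)
    {y : archGardingSpace hcpt τ} (hy0 : y ≠ 0)
    (hE : ((gardingEnd (hcpt := hcpt) (τ := τ) hτ (Matrix.single (0 : Fin 2) (1 : Fin 2) ((0, Pi.single w 1) : mixedSpace K)) - Complex.I • gardingEnd (hcpt := hcpt) (τ := τ) hτ (Matrix.single (0 : Fin 2) (1 : Fin 2) ((0, Pi.single w Complex.I) : mixedSpace K))) - (gardingEnd (hcpt := hcpt) (τ := τ) hτ (Matrix.single (1 : Fin 2) (0 : Fin 2) ((0, Pi.single w 1) : mixedSpace K)) + Complex.I • gardingEnd (hcpt := hcpt) (τ := τ) hτ (Matrix.single (1 : Fin 2) (0 : Fin 2) ((0, Pi.single w Complex.I) : mixedSpace K)))) y = 0) (hT : gardingEnd (hcpt := hcpt) (τ := τ) hτ (Matrix.single (0 : Fin 2) (0 : Fin 2) ((0, Pi.single w Complex.I) : mixedSpace K) - Matrix.single (1 : Fin 2) (1 : Fin 2) ((0, Pi.single w Complex.I) : mixedSpace K)) y = (Complex.I * m) • y) (hne : (gardingEnd (hcpt :=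 hcpt) (τ := τ) hτ (Matrix.single (0 : Fin 2) (1 : Fin 2) ((0, Pi.single w 1) : mixedSpace K)) - Complex.I • gardingEnd (hcpt := hcpt) (τ := τ) hτ (Matrix.single (0 : Fin 2) (1 : Fin 2) ((0, Pi.single w Complex.I) : mixedSpace K))) y ≠ 0) :
    |ν.im| < ((m : ℝ) + 2) / 2 := by
  obtain ⟨hle, heq⟩ := sq_im_besselParamC_le hτ w hτu hZ1 hZ2 hCa hCh hlama hy0 hE hT
  have h0 : (0 : ℝ) ≤ ((m : ℝ) + 2) / 2 := by positivity
  have hlt : ν.im ^ 2 < (((m : ℝ) + 2) / 2) ^ 2 := by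
    refine lt_of_le_of_ne hle fun h => hne ?_
    have hP := heq h
    -- `τ^a(E₁₀) y = τ^h(E₀₁) y` for a highest-weight vector
    have hM : (gardingEnd (hcpt := hcpt) (τ := τ) hτ (Matrix.single (1 : Fin 2) (0 : Fin 2) ((0, Pi.single w 1) : mixedSpace K)) + Complex.I • gardingEnd (hcpt := hcpt) (τ := τ) hτ (Matrix.single (1 : Fin 2) (0 : Fin 2) ((0, Pi.single w Complex.I) : mixedSpace K))) y = (gardingEnd (hcpt := hcpt) (τ := τ) hτ (Matrix.single (0 : Fin 2) (1 : Fin 2) ((0, Pi.single w 1) : mixedSpace K)) - Complex.I • gardingEnd (hcpt := hcpt) (τ := τ) hτ (Matrix.single (0 : Fin 2) (1 : Fin 2) ((0, Pi.single w Complex.I) : mixedSpace K))) y := (sub_eq_zero.mp (show (gardingEnd (hcpt := hcpt) (τ := τ) hτ (Matrix.single (0 : Fin 2) (1 : Fin 2) ((0, Pi.single w 1) : mixedSpace K)) - Complex.I • gardingEnd (hcpt := hcpt) (τ := τ) hτ (Matrix.single (0 : Fin 2) (1 : Fin 2) ((0, Pi.single w Complex.I) : mixedSpace K))) y - (gardingEnd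 (hcpt := hcpt) (τ := τ) hτ (Matrix.single (1 : Fin 2) (0 : Fin 2) ((0, Pi.single w 1) : mixedSpace K)) + Complex.I • gardingEnd (hcpt := hcpt) (τ := τ) hτ (Matrix.single (1 : Fin 2) (0 : Fin 2) ((0, Pi.single w Complex.I) : mixedSpace K))) y = 0 by
      rwa [LinearMap.sub_apply] at hE)).symm
    rw [LinearMap.add_apply, hM, ← two_smul ℂ] at hP
    exact (smul_eq_zero.mp hP).resolve_left two_ne_zero
  exact abs_lt_of_sq_lt_sq' hlt h0 |>.elim (fun h1 h2 => abs_lt.mpr ⟨h1, h2⟩)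

/-- **The complex-place unitarity bounds for an irreducible unitary generic `τ`.** For `τ` irreducible unitary
with a non-zero continuous Whittaker functional, central scalars `μ₁, μ₂`, Casimir scalars
`λ^a = (μ₁+iμ₂)²/2 - 2ν² - 2`, `λ^h = (μ₁-iμ₂)²/2 - 2ν'² - 2`, and a non-zero `K_∞`-finite highest-weight vector
`y` of torus weight `m` (`E y = 0`, `τ(T) y = im y`): `re μ₁ = re μ₂ = 0`, `conj λ^a = λ^h`, and
`|im ν|, |im ν'| < (m+2)/2 = m/2 + 1` (if `τ^h(E₀₁) y = 0` the Kirillov function of `y` would vanish). For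
`SL₂(ℂ)`: the unitary principal series and the complementary series of parameter `< 1` (Knapp, Thm. 16.2 for
`SL(2,ℂ)`); the sharper `im ν = m/2` on strings is `im_besselParamC_eq_half_of_string`.
[cite: Knapp1986, Ch. XVI §1, Thm. 16.2] [cite: JacquetLanglands1970, §6 Thm. 6.2] -/
theorem complexPlace_unitarityBounds (hτu : τ.IsUnitary) (hτi : τ.IsTopIrreducible)
    {ℓ : archGardingSpace hcpt τ →ₗ[ℂ] ℂ} (hℓW : IsArchContWhittakerFunctional hcpt τ hτ ℓ) (hne : ℓ ≠ 0)
    {μ₁ μ₂ lama lamh ν ν' : ℂ} {m : ℕ}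
    (hZ1 : ∀ v : archGardingSpace hcpt τ, gardingEnd (hcpt := hcpt) (τ := τ) hτ (Matrix.single 0 0 ((0, Pi.single w 1) : mixedSpace K) + Matrix.single 1 1 ((0, Pi.single w 1) : mixedSpace K)) v = μ₁ • v)
    (hZ2 : ∀ v : archGardingSpace hcpt τ, gardingEnd (hcpt := hcpt) (τ := τ) hτ (Matrix.single (0 : Fin 2) (0 : Fin 2) ((0, Pi.single w Complex.I) : mixedSpace K) + Matrix.single (1 : Fin 2) (1 : Fin 2) ((0, Pi.single w Complex.I) : mixedSpace K)) v = μ₂ • v)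
    (hCa : ∀ v : archGardingSpace hcpt τ, ∑ i : Fin 2, ∑ j : Fin 2, (gardingEnd (hcpt := hcpt) (τ := τ) hτ (Matrix.single (i : Fin 2) (j : Fin 2) ((0, Pi.single w 1) : mixedSpace K)) + Complex.I • gardingEnd (hcpt := hcpt) (τ := τ) hτ (Matrix.single (i : Fin 2) (j : Fin 2) ((0, Pi.single w Complex.I) : mixedSpace K))) ((gardingEnd (hcpt := hcpt) (τ := τ) hτ (Matrix.single (j : Fin 2) (i : Fin 2) ((0, Pi.single w 1) : mixedSpace K)) + Complex.I • gardingEnd (hcpt := hcpt) (τ := τ) hτ (Matrix.single (j : Fin 2) (i : Fin 2) ((0, Pi.single w Complex.I) : mixedSpace K))) v) = lama • v)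
    (hCh : ∀ v : archGardingSpace hcpt τ, ∑ i : Fin 2, ∑ j : Fin 2, (gardingEnd (hcpt := hcpt) (τ := τ) hτ (Matrix.single (i : Fin 2) (j : Fin 2) ((0, Pi.single w 1) : mixedSpace K)) - Complex.I • gardingEnd (hcpt := hcpt) (τ := τ) hτ (Matrix.single (i : Fin 2) (j : Fin 2) ((0, Pi.single w Complex.I) : mixedSpace K))) ((gardingEnd (hcpt := hcpt) (τ := τ) hτ (Matrix.single (j : Fin 2) (i : Fin 2) ((0, Pi.single w 1) : mixedSpace K)) - Complex.I • gardingEnd (hcpt := hcpt) (τ := τ) hτ (Matrix.single (j : Fin 2) (i : Fin 2) ((0, Pi.single w Complex.I) : mixedSpace K))) v) = lamh • v)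
    (hlama : lama = (μ₁ + Complex.I * μ₂) ^ 2 / 2 - 2 * ν ^ 2 - 2)
    (hlamh : lamh = (μ₁ - Complex.I * μ₂) ^ 2 / 2 - 2 * ν' ^ 2 - 2)
    {y : archGardingSpace hcpt τ} (hyK : y ∈ archKFinite hτ) (hy0 : y ≠ 0)
    (hE : ((gardingEnd (hcpt := hcpt) (τ := τ) hτ (Matrix.single (0 : Fin 2) (1 : Fin 2) ((0, Pi.single w 1) : mixedSpace K)) - Complex.I • gardingEnd (hcpt := hcpt) (τ := τ) hτ (Matrix.single (0 : Fin 2) (1 : Fin 2) ((0, Pi.single w Complex.I) : mixedSpace K))) - (gardingEnd (hcpt := hcpt) (τ := τ) hτ (Matrix.single (1 : Fin 2) (0 : Fin 2) ((0, Pi.single w 1) : mixedSpace K)) + Complex.I • gardingEnd (hcpt := hcpt) (τ := τ) hτ (Matrix.single (1 : Fin 2) (0 : Fin 2) ((0, Pi.single w Complex.I) : mixedSpace K)))) y = 0) (hT : gardingEnd (hcpt := hcpt) (τ := τ) hτ (Matrix.single (0 : Fin 2) (0 : Fin 2) ((0, Pi.single w Complex.I) : mixedSpace K) - Matrix.single (1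 : Fin 2) (1 : Fin 2) ((0, Pi.single w Complex.I) : mixedSpace K)) y = (Complex.I * m) • y) :
    μ₁.re = 0 ∧ μ₂.re = 0 ∧ conj lama = lamh ∧ |ν.im| < ((m : ℝ) + 2) / 2 ∧ |ν'.im| < ((m : ℝ) + 2) / 2 := by
  obtain ⟨hμ₁, hμ₂⟩ := re_complexCentral_eq_zero hτ w hτu hZ1 hZ2 hy0
  have hconj : conj lama = lamh := conj_placeCasimirAnti_eq hτ w hτu hy0 (hCa y) (hCh y)
  obtain ⟨-, him, -⟩ := besselParamC_sq_eq_conj_sq hμ₁ hμ₂ hconj hlama hlamh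
  have hne' : (gardingEnd (hcpt := hcpt) (τ := τ) hτ (Matrix.single (0 : Fin 2) (1 : Fin 2) ((0, Pi.single w 1) : mixedSpace K)) - Complex.I • gardingEnd (hcpt := hcpt) (τ := τ) hτ (Matrix.single (0 : Fin 2) (1 : Fin 2) ((0, Pi.single w Complex.I) : mixedSpace K))) y ≠ 0 := by
    intro h0
    refine not_mem_kirillovNull_of_mem_archKFinite hτ hτu hτi hℓW hne hyK hy0 ?_
    refine mem_kirillovNull_of_hol01_mem hτ hℓW w ?_
    rw [h0]
    exact Submodule.zero_mem _
  have hlt := abs_im_besselParamC_lt_of_ne hτ w hτu hZ1 hZ2 hCa hCh hlama hy0 hE hT hne'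
  exact ⟨hμ₁, hμ₂, hconj, hlt, him ▸ hlt⟩

/-- **The bounds for the inner data `ComplexInner y m` of the complex shape types** (`ArchKirillovShapeTypesGL2`):
`|im ν|, |im ν'| < m/2 + 1` for a non-zero `K_∞`-finite `y` with `ComplexInner hτ w y m`. [cite: Knapp1986, Ch. XVI §1, Thm. 16.2] -/
theorem ComplexInner.unitarityBounds (hτu : τ.IsUnitary) (hτi : τ.IsTopIrreducible)
    {ℓ : archGardingSpace hcpt τ →ₗ[ℂ] ℂ} (hℓW : IsArchContWhittakerFunctional hcpt τ hτ ℓ) (hne : ℓ ≠ 0)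
    {μ₁ μ₂ lama lamh ν ν' : ℂ} {m : ℕ}
    (hZ1 : ∀ v : archGardingSpace hcpt τ, gardingEnd (hcpt := hcpt) (τ := τ) hτ (Matrix.single 0 0 ((0, Pi.single w 1) : mixedSpace K) + Matrix.single 1 1 ((0, Pi.single w 1) : mixedSpace K)) v = μ₁ • v)
    (hZ2 : ∀ v : archGardingSpace hcpt τ, gardingEnd (hcpt := hcpt) (τ := τ) hτ (Matrix.single (0 : Fin 2) (0 : Fin 2) ((0, Pi.single w Complex.I) : mixedSpace K) + Matrix.single (1 : Fin 2) (1 : Fin 2) ((0, Pi.single w Complex.I) : mixedSpace K)) v = μ₂ • v)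
    (hCa : ∀ v : archGardingSpace hcpt τ, ∑ i : Fin 2, ∑ j : Fin 2, (gardingEnd (hcpt := hcpt) (τ := τ) hτ (Matrix.single (i : Fin 2) (j : Fin 2) ((0, Pi.single w 1) : mixedSpace K)) + Complex.I • gardingEnd (hcpt := hcpt) (τ := τ) hτ (Matrix.single (i : Fin 2) (j : Fin 2) ((0, Pi.single w Complex.I) : mixedSpace K))) ((gardingEnd (hcpt := hcpt) (τ := τ) hτ (Matrix.single (j : Fin 2) (i : Fin 2) ((0, Pi.single w 1) : mixedSpace K)) + Complex.I • gardingEnd (hcpt := hcpt) (τ := τ) hτ (Matrix.single (j : Fin 2) (i : Fin 2) ((0, Pi.single w Complex.I) : mixedSpace K))) v) = lama • v)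
    (hCh : ∀ v : archGardingSpace hcpt τ, ∑ i : Fin 2, ∑ j : Fin 2, (gardingEnd (hcpt := hcpt) (τ := τ) hτ (Matrix.single (i : Fin 2) (j : Fin 2) ((0, Pi.single w 1) : mixedSpace K)) - Complex.I • gardingEnd (hcpt := hcpt) (τ := τ) hτ (Matrix.single (i : Fin 2) (j : Fin 2) ((0, Pi.single w Complex.I) : mixedSpace K))) ((gardingEnd (hcpt := hcpt) (τ := τ) hτ (Matrix.single (j : Fin 2) (i : Fin 2) ((0, Pi.single w 1) : mixedSpace K)) - Complex.I • gardingEnd (hcpt := hcpt) (τ := τ) hτ (Matrix.single (j : Fin 2) (i : Fin 2) ((0, Pi.single w Complex.I) : mixedSpace K))) v) = lamh • v)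
    (hlama : lama = (μ₁ + Complex.I * μ₂) ^ 2 / 2 - 2 * ν ^ 2 - 2)
    (hlamh : lamh = (μ₁ - Complex.I * μ₂) ^ 2 / 2 - 2 * ν' ^ 2 - 2)
    {y : archGardingSpace hcpt τ} (hyK : y ∈ archKFinite hτ) (hy0 : y ≠ 0) (hy : ComplexInner hτ w y m) :
    μ₁.re = 0 ∧ μ₂.re = 0 ∧ conj lama = lamh ∧ |ν.im| < ((m : ℝ) + 2) / 2 ∧ |ν'.im| < ((m : ℝ) + 2) / 2 :=
  complexPlace_unitarityBounds hτ w hτu hτi hℓW hne hZ1 hZ2 hCa hCh hlama hlamh hyK hy0 hy.1 hy.2.1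

end ComplexPlace

end Literature.NumberTheory.Automorphic
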